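import Literature.Computability.MetaComplexity.EFOpKit
import Literature.Computability.MetaComplexity.EFModMulUAssocS
import HarnessLib

/-!
# The operation kit of uniform modular multiplication, I: rules, result wires, the domain law

Towards the instance of the operation-kit interface (`ModAdd.OpKit`, `EFOpKit.lean`) given by the
certified uniform modular multiplier `ModMulU.mulRT L` (`EFModMulURange.lean`) on `L`-bit
words: `x ∘ y = x · y mod n` (for `x < n`). This file fixes the rule package of the kit
(`MulKit.MRules`: the arithmetic/chain rules of the kit layers together with all rule lists of
the uniform multiplier library), the result wires `P_L` and the internal comparator of the
product with `n`, and proves the **domain law** (`MulKit.dom`): from `x < n` the product is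
`< n`, by transporting the certificate to the multiplier's own comparator of `x` and the range
law `ModMulU.View.isBlock_rangeLines`.

## Sources

* S. A. Cook, R. A. Reckhow, *The relative efficiency of propositional proof systems*,
  J. Symbolic Logic 44 (1979), §2.
* J. Krajíček, *Bounded Arithmetic, Propositional Logic, and Complexity Theory* (CUP 1995), §9.2.
-/

namespace Literature.Computability.MetaComplexity

open _root_.Computability Complexity Complexity.PropForm FregeSystem Netlist ModAdd

namespace MulKit

/-! ### The rule package -/

/-- The rule lists of the uniform multiplier library. [folklore] -/
def uRules : List FregeRule :=
  ModMulU.Comm.rules ++ ModMulU.One.rules ++ ModMulU.Sys.glue ++ ModMulU.Sys.sysRules ++ ModAddU.assocRules ++ ModAddU.rules ++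
    ModMulU.rangeRules ++ ModAddU.glueRules ++ ModMulU.LD.maskRules ++ ModMulU.MaskMul.rules

/-- Every rule of the uniform multiplier library is sound. [cite: CookReckhow1979, §2 (sound rule)] -/
theorem isSound_of_mem_uRules : ∀ r ∈ uRules, r.IsSound := by
  intro r hr
  simp only [uRules, List.mem_append] at hr
  rcases hr with ((((((((hr | hr) | hr) | hr) | hr) | hr) | hr) | hr) | hr) | hr
  exacts [ModMulU.Comm.isSound_of_mem_rules r hr, ModMulU.One.isSound_of_mem_rules r hr, ModMulU.Sys.isSound_of_mem_glue r hr,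
    ModMulU.Sys.isSound_of_mem_sysRules r hr, ModAddU.isSound_of_mem_assocRules r hr, ModAddU.isSound_of_mem_rules r hr,
    ModMulU.isSound_of_mem_rangeRules r hr, ModAddU.isSound_of_mem_glueRules r hr, ModMulU.LD.isSound_of_mem_maskRules r hr,
    ModMulU.MaskMul.isSound_of_mem_rules r hr]

/-- `MRules G`: the Frege system contains the rules of the kit: the arithmetic/chain rules of the
kit layers (`ARulesOK`) and the uniform multiplier library. [folklore] -/
structure MRules (G : FregeSystem) : Prop where
  /-- the arithmetic rules of the kit layers -/
  arith : ARulesOK G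
  /-- commutativity development -/
  comm : ∀ r ∈ ModMulU.Comm.rules, r ∈ G.rules
  /-- unit law -/
  one : ∀ r ∈ ModMulU.One.rules, r ∈ G.rules
  /-- carry systems: glue -/
  glue : ∀ r ∈ ModMulU.Sys.glue, r ∈ G.rules
  /-- carry systems -/
  sys : ∀ r ∈ ModMulU.Sys.sysRules, r ∈ G.rules
  /-- associativity of `⊕` -/
  assocU : ∀ r ∈ ModAddU.assocRules, r ∈ G.rules
  /-- modular addition -/
  modAddU : ∀ r ∈ ModAddU.rules, r ∈ G.rules
  /-- range -/
  range : ∀ r ∈ ModMulU.rangeRules, r ∈ G.rules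
  /-- glue of `⊕` -/
  glueU : ∀ r ∈ ModAddU.glueRules, r ∈ G.rules
  /-- masks -/
  mask : ∀ r ∈ ModMulU.LD.maskRules, r ∈ G.rules
  /-- mask multiplication -/
  maskMul : ∀ r ∈ ModMulU.MaskMul.rules, r ∈ G.rules

/-- The rule list of the kit. [folklore] -/
def ruleList : List FregeRule := allRulesA ++ uRules

/-- Every rule of the kit is sound. [cite: CookReckhow1979, §2 (sound rule)] -/
theorem isSound_of_mem_ruleList : ∀ r ∈ ruleList, r.IsSound := fun r hr => by
  rcases List.mem_append.1 hr with hr | hr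
  exacts [isSound_allRulesA r hr, isSound_of_mem_uRules r hr]

/-- A Frege system containing the rule list has the rules of the kit. [folklore] -/
theorem mRules_of {G : FregeSystem} (hG : ∀ r ∈ ruleList, r ∈ G.rules) : MRules G := by
  have hA : ∀ r ∈ allRulesA, r ∈ G.rules := fun r hr => hG r (List.mem_append_left _ hr)
  have hU : ∀ {l : List FregeRule}, (∀ r ∈ l, r ∈ uRules) → ∀ r ∈ l, r ∈ G.rules := fun h r hr => hG r (List.mem_append_right _ (h r hr))
  have h := aRulesOK_allRulesA
  refine ⟨⟨⟨fun r hr => hA r (h.netlist r hr), fun r hr => hA r (h.logic r hr), fun r hr => hA r (h.adder r hr), fun r hr => hA r (h.adderLaw r hr),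
    fun r hr => hA r (h.sub r hr), fun r hr => hA r (h.order r hr), fun r hr => hA r (h.muxNat r hr), fun r hr => hA r (h.modAdd r hr)⟩,
    fun r hr => hA r (h.assoc r hr)⟩, ?_, ?_, ?_, ?_, ?_, ?_, ?_, ?_, ?_, ?_⟩ <;> refine hU fun r hr => ?_ <;> simp [uRules, hr]

/-! ### Result wires and the comparator of the product -/

variable (L : ℕ)

/-- Offset of bit `i` of the product `P_L` in the certified multiplier (`L ≥ 1`). [folklore] -/
def resOff (i : ℕ) : ℕ := ModMulU.offA L (L - 1) + (5 * L + 2) + i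

/-- Offset of the comparator of the product with `n` (the last comparator). [folklore] -/
def cmpOff : ℕ := ModMulU.ML L + (4 + 3 * (L - 1)) * (3 * L + 1)

variable {L}

/-- The result wires are gates of the multiplier (`L ≥ 1`). [folklore] -/
theorem resOff_lt (hL : 0 < L) {i : ℕ} (hi : i < L) : resOff L i < (ModMulU.mulRT L).length := by
  rw [ModMulU.length_mulRT]
  unfold resOff ModMulU.offA ModMulU.offD ModMulU.ML
  obtain ⟨L', rfl⟩ : ∃ L', L = L' + 1 := ⟨L - 1, by omega⟩
  simp only [Nat.add_sub_cancel]
  nlinarith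

/-- The product word of the view of an occurrence is the result word. [folklore] -/
theorem P_eq (hL : 0 < L) (o : Occ) (i : ℕ) : (ModMulU.viewOf o L).P L L i = o.base + resOff L i := by
  simp only [ModMulU.View.P, Nat.pos_iff_ne_zero.1 hL, if_false, ModMulU.viewOf, resOff]; ring

/-- The base of the comparator of the product. [folklore] -/
theorem bCP_eq (hL : 0 < L) (o : Occ) : (ModMulU.viewOf o L).bCP L L = o.base + cmpOff L := by
  simp only [ModMulU.View.bCP, Nat.pos_iff_ne_zero.1 hL, if_false, ModMulU.View.rbase, ModMulU.viewOf, cmpOff]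
  rw [show 5 + 3 * (L - 1) - 1 = 4 + 3 * (L - 1) by omega]

/-- The comparison bit of the product comparator. [folklore] -/
theorem ge_CP_eq (hL : 0 < L) (o : Occ) :
    ((ModMulU.viewOf o L).CP L L).ge L L = ((⟨o.base + cmpOff L, fun i => o.base + resOff L i, on L o⟩ : Sub.View)).ge L L := by
  simp only [Sub.View.ge, Sub.View.adder, Adder.View.c, Adder.View.wire, ModMulU.View.CP, bCP_eq hL]

/-- **The comparator of the product is available** in an available occurrence. [folklore] -/
theorem cmp_avail (hL : 0 < L) {K : PropForm ℕ} {Γ : Set (PropForm ℕ)} (o : Occ) (ho : o.Avail (ModMulU.mulRT L) (3 * L) K Γ) :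
    ((⟨o.base + cmpOff L, fun i => o.base + resOff L i, on L o⟩ : Sub.View)).Avail K Γ L :=
  ((ModMulU.ravail_ofOcc ho).hCP le_rfl).congr (bCP_eq hL o).symm (fun i _ => (P_eq hL o i).symm) fun _ _ => rfl

/-! ### The domain law -/

variable {G : FregeSystem} {K : PropForm ℕ} {Γ : Set (PropForm ℕ)}

/-- Size coefficient of the domain law. [folklore] -/
def domC (L : ℕ) : ℕ × ℕ := ((L + 2) + L * (3 * L + 8) + (5 * L + 2), 153)

/-- **The domain law**: from `x < n`, the product `x ∘ y` is `< n`. The certificate is transported to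
the multiplier's own comparator of `x` with `n`, then the range law gives `P_L < n`.
[cite: Krajicek1995, §9.2] -/
theorem dom (hG : MRules G) (hL : 0 < L) {o : Occ} (ho : o.Avail (ModMulU.mulRT L) (3 * L) K Γ) (hx : LtN L K Γ (ox o) (on L o)) :
    G.Yields Γ {ctx K (neg (var (((⟨o.base + cmpOff L, fun i => o.base + resOff L i, on L o⟩ : Sub.View)).ge L L)))} ((domC L).1 * (K.size + (domC L).2)) := by
  have hR := ModMulU.ravail_ofOcc ho
  have hΓ : ∀ {X : Set (PropForm ℕ)}, Γ ⊆ Γ ∪ X := fun {X} => Set.subset_union_left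
  -- transport `x < n` to the comparator `CA` of the multiplier
  have b1 := (Yields.eqW_refl hG.arith.adder K (ox o) L (Γ := Γ)).union (Yields.eqW_refl hG.arith.adder K (on L o) L)
  set A1 := ctxSet K (eqW (ox o) (ox o) L) ∪ ctxSet K (eqW (on L o) (on L o) L) with hA1
  have b2 := LtN.transport hG.arith.toRulesOK (hx.mono (hΓ (X := A1))) ((ModMulU.viewOf o L).CA L) (hR.hCA.mono hΓ) le_rfl
    (fun i hi => Or.inr (Or.inl (mem_ctxSet (mem_eqW hi)))) (fun i hi => Or.inr (Or.inr (mem_ctxSet (mem_eqW hi))))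
  set A2 := A1 ∪ {ctx K (neg (var (((ModMulU.viewOf o L).CA L).ge L L)))} with hA2
  -- the range law
  have b3 : G.Yields (Γ ∪ A2) {ctx K (neg (var (((ModMulU.viewOf o L).CP L L).ge L L)))} ((L + 2) * (K.size + 10) + L * ((3 * L + 8) * (K.size + 153))) :=
    Yields.of_isBlock (ModMulU.View.isBlock_rangeLines hG.range hG.modAddU hG.arith.adder (hR.mono hΓ) (Or.inr (Or.inr rfl)))
      (fun θ hθ => by rw [Set.mem_singleton_iff.1 hθ]; exact ModMulU.View.mem_rangeLines_out) ModMulU.View.proofSize_rangeLines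
  have h := (b1.trans b2).trans b3
  rw [ge_CP_eq hL] at h
  refine (h.mono_right fun θ hθ => Or.inr hθ).mono_size ?_
  simp only [domC]; nlinarith [Nat.zero_le K.size, Nat.zero_le L]

end MulKit

end Literature.Computability.MetaComplexity

/-!
# The operation kit of uniform modular multiplication, II: the unit law `1 ∘ y = y`

The left unit law of the kit of `ModMulU.mulRT L`: if the first operand `x` of an available
occurrence is the one-hot word (`x₀` true, `xᵢ` false for `i ≥ 1`, as literals) and `y < n`, then
the product equals `y` bitwise (`MulKit.unitL`). The auxiliary template `MulKit.unitT L`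
(inputs `y, n`): a true gate `c`, a false gate `z`, a multiplier `M' = (c, z, …, z) ⊗ y`
(`ModMulU.mulT`) and the unit kit `ModMulU.One.oneT` on `(y, n, z)`. The library's unit law
(`ModMulU.One.isBlock_lines`) gives `P_L(M')ᵢ ↔ c ∧ yᵢ`, hence `P_L(M') ≡ y` (`c` is true);
the congruence of multipliers (`ModMulU.PairData`) along `c ≡ x₀`, `z ≡ xᵢ` gives
`P_L(M') ≡ x ∘ y`.

## Sources

* S. A. Cook, R. A. Reckhow, *The relative efficiency of propositional proof systems*,
  J. Symbolic Logic 44 (1979), §2.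
* J. Krajíček, *Bounded Arithmetic, Propositional Logic, and Complexity Theory* (CUP 1995), §9.2.
-/

namespace Literature.Computability.MetaComplexity

open _root_.Computability Complexity Complexity.PropForm FregeSystem Netlist ModAdd

namespace MulKit

variable (L : ℕ)

/-! ### The auxiliary template -/

/-- The two constant gates: `c = ⊤` (gate `0`), `z = ⊥` (gate `1`). [folklore] -/
def cstT : Template := [⟨Kind.cst true, []⟩, ⟨Kind.cst false, []⟩]

/-- Wiring of the multiplier `M' = (c, z, …, z) ⊗ y` (inputs of the template: `y` = `0…L-1`,
`n` = `L…2L-1`). [folklore] -/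
def wM (i : ℕ) : ℕ ⊕ ℕ := if i < L then (if i = 0 then Sum.inr 0 else Sum.inr 1) else Sum.inl (i - L)

/-- Wiring of the unit kit: `a := y`, `n`, `z`. [folklore] -/
def wO (i : ℕ) : ℕ ⊕ ℕ := if i < 2 * L then Sum.inl i else Sum.inr 1

/-- The pieces of the unit template. [folklore] -/
def uPieces : ℕ → Piece
  | 0 => ⟨cstT, 0, Sum.inl⟩
  | 1 => ⟨ModMulU.mulT L, 3 * L, wM L⟩
  | _ => ⟨ModMulU.One.oneT L, 2 * L + 1, wO L⟩

/-- **The unit template.** [folklore] -/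
def unitT : Template := layout (uPieces L) 3

/-- The pieces are well formed and well wired (`2L` inputs). [folklore] -/
theorem uPiece_ok : ∀ k < 3, Piece.OK (uPieces L) (2 * L) k := by
  intro k hk
  have hk3 : k = 0 ∨ k = 1 ∨ k = 2 := by omega
  rcases hk3 with rfl | rfl | rfl
  · refine ⟨fun g hg => ?_, fun i hi => absurd hi (Nat.not_lt_zero i)⟩
    have hg2 : g < 2 := by simpa [uPieces, cstT] using hg
    have : g = 0 ∨ g = 1 := by omega
    rcases this with rfl | rfl <;> exact ⟨rfl, fun a ha => by simp [uPieces, cstT] at ha⟩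
  · have h1 : offset (uPieces L) 1 = 2 := by rw [show (1 : ℕ) = 0 + 1 from rfl, offset_succ, offset_zero]; rfl
    refine ⟨ModMulU.wf_mulT L, fun i hi => ?_⟩
    show (∀ a, wM L i = Sum.inl a → a < 2 * L) ∧ ∀ g, wM L i = Sum.inr g → g < offset (uPieces L) 1
    rw [h1]; unfold wM; split_ifs with c1 c2
    · exact ⟨fun a ha => (by cases ha), fun g hg => (by cases hg; omega)⟩
    · exact ⟨fun a ha => (by cases ha), fun g hg => (by cases hg; omega)⟩
    · exact ⟨fun a ha => (by cases ha; change i < 3 * L at hi; omega), fun g hg => (by cases hg)⟩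
  · have h2 : offset (uPieces L) 2 = 2 + (ModMulU.mulT L).length := by
      rw [show (2 : ℕ) = 1 + 1 from rfl, offset_succ, show (1 : ℕ) = 0 + 1 from rfl, offset_succ, offset_zero]; rfl
    refine ⟨ModMulU.One.wf_oneT L, fun i hi => ?_⟩
    show (∀ a, wO L i = Sum.inl a → a < 2 * L) ∧ ∀ g, wO L i = Sum.inr g → g < offset (uPieces L) 2
    rw [h2]; unfold wO; split_ifs with c1
    · exact ⟨fun a ha => (by cases ha; omega), fun g hg => (by cases hg)⟩
    · exact ⟨fun a ha => (by cases ha), fun g hg => (by cases hg; omega)⟩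

/-- **The unit template is well formed** (`2L` inputs). [cite: Vollmer1999, Def. 1.6] -/
theorem wf_unitT : (unitT L).WF (2 * L) := wf_layout (uPieces L) (uPiece_ok L)

/-- The sources of the unit template: `y` and `n` of the occurrence. [folklore] -/
def unitSrc (q : ℕ) : Src := if q < L then Src.inp 0 (L + q) else Src.inp 0 (2 * L + (q - L))

/-- The sources are in range. [folklore] -/
theorem unitSrc_ok (q : ℕ) (hq : q < 2 * L) : (unitSrc L q).OK 1 (3 * L) (ModMulU.mulRT L).length := by
  unfold unitSrc; split_ifs <;> exact ⟨Nat.one_pos, by omega⟩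

/-- The unit auxiliary. [folklore] -/
def unitA : LawAux := ⟨unitT L, 2 * L, unitSrc L⟩

variable {L} {G : FregeSystem} {K : PropForm ℕ} {Γ : Set (PropForm ℕ)}

/-! ### The occurrences inside the auxiliary -/

section Inside

variable (a : Occ) (L) {o : Occ}

/-- The constants. [folklore] -/
def Cst : Occ := pieceOcc (a.inst (2 * L)) (uPieces L) 0
/-- The multiplier `M'`. [folklore] -/
def Mp : Occ := pieceOcc (a.inst (2 * L)) (uPieces L) 1
/-- The unit kit. [folklore] -/
def On : Occ := pieceOcc (a.inst (2 * L)) (uPieces L) 2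
/-- The true gate. [folklore] -/
def cg : ℕ := a.base
/-- The false gate. [folklore] -/
def zg : ℕ := a.base + 1

variable {a L}

/-- Offsets. [folklore] -/
theorem offsets : offset (uPieces L) 0 = 0 ∧ offset (uPieces L) 1 = 2 ∧ offset (uPieces L) 2 = 2 + (ModMulU.mulT L).length := by
  refine ⟨offset_zero _, ?_, ?_⟩
  · rw [show (1 : ℕ) = 0 + 1 from rfl, offset_succ, offset_zero]; rfl
  · rw [show (2 : ℕ) = 1 + 1 from rfl, offset_succ, show (1 : ℕ) = 0 + 1 from rfl, offset_succ, offset_zero]; rfl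

/-- Inputs of `M'`. [folklore] -/
theorem Mp_inp (ha : ∀ q < 2 * L, a.inp q = (unitSrc L q).val fun _ => (o : Occ)) :
    (∀ i < L, (Mp L a).inp i = if i = 0 then cg a else zg a) ∧ (∀ i < L, (Mp L a).inp (L + i) = o.inp (L + i)) ∧
      ∀ i < L, (Mp L a).inp (2 * L + i) = o.inp (2 * L + i) := by
  refine ⟨fun i hi => ?_, fun i hi => ?_, fun i hi => ?_⟩
  · rw [Mp, inp_pieceOcc]; show (a.inst (2 * L)).ref (wM L i) = _
    unfold wM; rw [if_pos hi]; split_ifs <;> simp [Inst.ref, Inst.wire, cg, zg]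
  · rw [Mp, inp_pieceOcc]; show (a.inst (2 * L)).ref (wM L (L + i)) = _
    unfold wM; rw [if_neg (by omega), Nat.add_sub_cancel_left, Occ.ref_inl _ (by omega), ha i (by omega)]
    unfold unitSrc; rw [if_pos hi]; rfl
  · rw [Mp, inp_pieceOcc]; show (a.inst (2 * L)).ref (wM L (2 * L + i)) = _
    unfold wM; rw [if_neg (by omega), show 2 * L + i - L = L + i by omega, Occ.ref_inl _ (by omega), ha (L + i) (by omega)]
    unfold unitSrc; rw [if_neg (by omega), show 2 * L + (L + i - L) = 2 * L + i by omega]; rfl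

/-- Inputs of the unit kit. [folklore] -/
theorem On_inp (ha : ∀ q < 2 * L, a.inp q = (unitSrc L q).val fun _ => (o : Occ)) :
    (∀ i < L, (On L a).inp i = o.inp (L + i)) ∧ (∀ i < L, (On L a).inp (L + i) = o.inp (2 * L + i)) ∧ (On L a).inp (2 * L) = zg a := by
  refine ⟨fun i hi => ?_, fun i hi => ?_, ?_⟩
  · rw [On, inp_pieceOcc]; show (a.inst (2 * L)).ref (wO L i) = _
    unfold wO; rw [if_pos (by omega), Occ.ref_inl _ (by omega), ha i (by omega)]; unfold unitSrc; rw [if_pos hi]; rfl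
  · rw [On, inp_pieceOcc]; show (a.inst (2 * L)).ref (wO L (L + i)) = _
    unfold wO; rw [if_pos (by omega), Occ.ref_inl _ (by omega), ha (L + i) (by omega)]; unfold unitSrc
    rw [if_neg (by omega), show 2 * L + (L + i - L) = 2 * L + i by omega]; rfl
  · rw [On, inp_pieceOcc]; show (a.inst (2 * L)).ref (wO L (2 * L)) = _
    unfold wO; rw [if_neg (by omega)]; simp [Inst.ref, Inst.wire, zg]

/-- Availability of the pieces. [folklore] -/
theorem pieces_avail (hA : a.Avail (unitT L) (2 * L) K Γ) :
    ctx K (biimp (var (cg a)) (const true)) ∈ Γ ∧ ctx K (biimp (var (zg a)) (const false)) ∈ Γ ∧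
      (Mp L a).Avail (ModMulU.mulT L) (3 * L) K Γ ∧ (On L a).Avail (ModMulU.One.oneT L) (2 * L + 1) K Γ := by
  have hI : (a.inst (2 * L)).DefsAvail (layout (uPieces L) 3) K Γ := hA
  have h0 : (Cst L a).Avail cstT 0 K Γ := Inst.DefsAvail.piece hI (k := 0) (by omega) (uPiece_ok L 0 (by omega)).1
  refine ⟨?_, ?_, Inst.DefsAvail.piece hI (k := 1) (by omega) (ModMulU.wf_mulT L), Inst.DefsAvail.piece hI (k := 2) (by omega) (ModMulU.One.wf_oneT L)⟩
  · have h := h0 0 (by simp [cstT]); simpa [cstT, Inst.body, Kind.body, Cst, pieceOcc, offsets.1, Inst.wire, cg] using h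
  · have h := h0 1 (by simp [cstT]); simpa [cstT, Inst.body, Kind.body, Cst, pieceOcc, offsets.1, Inst.wire, zg] using h

end Inside

/-! ### The unit law -/

/-- Size coefficient of the unit law. [folklore] -/
def unitC (L : ℕ) : ℕ × ℕ := (40 * (L + 1) * (L + 1), 100)

/-- **The left unit law of the kit**: `1 ∘ y = y` bitwise for `y < n`. [cite: Krajicek1995, §9.2] -/
theorem unitL (hG : MRules G) (hL : 0 < L) {o a : Occ} (ho : o.Avail (ModMulU.mulRT L) (3 * L) K Γ) (hA : a.Avail (unitT L) (2 * L) K Γ)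
    (hw : AuxWired (2 * L) (unitSrc L) (fun _ => o) a) (hx : Holds K Γ (litW (ox o) (fun i => decide (i = 0)) L)) (hy : LtN L K Γ (oy L o) (on L o)) :
    G.Yields Γ (ctxSet K (eqW (fun i => o.base + resOff L i) (oy L o) L)) ((unitC L).1 * (K.size + (unitC L).2)) := by
  have hΓ : ∀ {X : Set (PropForm ℕ)}, Γ ⊆ Γ ∪ X := fun {X} => Set.subset_union_left
  obtain ⟨hc, hz, hM, hO⟩ := pieces_avail hA
  obtain ⟨hMa, hMb, hMn⟩ := Mp_inp (a := a) (L := L) (o := o) hw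
  obtain ⟨hOa, hOn, hOz⟩ := On_inp (a := a) (L := L) (o := o) hw
  obtain ⟨b, hb, hblt⟩ := hy
  have hR := ModMulU.ravail_ofOcc ho
  set V := ModMulU.viewOf (Mp L a) L with hV
  have hVA : V.Avail L K Γ := ModMulU.avail_ofOcc hM
  -- the unit law of the library: `P_L(M')ᵢ ↔ c ∧ yᵢ`
  have hA0 : (ModMulU.One.CA L (On L a) b 0).Avail K Γ L :=
    hb.congr rfl (fun i hi => by show ModMulU.One.Aw L (On L a) 0 i = _; rw [ModMulU.One.Aw_zero hi, hOa i hi]; rfl)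
      fun i hi => by show ModMulU.One.nw L (On L a) i = _; unfold ModMulU.One.nw; rw [hOn i hi]; rfl
  have b1 : G.Yields Γ {χ | χ ∈ ModMulU.One.lines L (On L a) K V (cg a) b} ((18 * L * L + 8 * L + 2) * (K.size + 100)) :=
    Yields.of_isBlock (ModMulU.One.isBlock_lines hG.one hG.glue hG.sys hG.arith.logic hO hVA (hMa 0 hL)
      (fun i h1 hi => by show (Mp L a).inp i = _; rw [hMa i hi, if_neg (by omega), ← hOz]; rfl) (fun j hj => by show (Mp L a).inp (L + j) = _; rw [hMb j hj, hOa j hj])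
      (fun i hi => by show (Mp L a).inp (2 * L + i) = _; unfold ModMulU.One.nw; rw [hMn i hi, hOn i hi]) (by unfold ModMulU.One.zg; rw [hOz]; exact hz)
      hA0 hblt hL) subset_rfl (ModMulU.One.proofSize_lines _ _ _ _ _ hL)
  set A1 := {χ | χ ∈ ModMulU.One.lines L (On L a) K V (cg a) b} with hA1
  -- `c` is true, so `P_L(M') ≡ y`
  have b2 : G.Yields (Γ ∪ A1) {ctx K (var (cg a))} (K.size + 10) :=
    (Yields.single (Logic.infer hG.arith.logic 12 (by decide) (FregeSystem.sub [K, var (cg a)]) (θ := ctx K (var (cg a))) rfl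
      (FregeSystem.prems_cons (hΓ hc) FregeSystem.prems_nil))).mono_size (by simp [ctx, size])
  set A2 := A1 ∪ {ctx K (var (cg a))} with hA2
  have b3 : G.Yields (Γ ∪ A2) (ctxSet K (eqW (V.P L L) (oy L o) L)) (L * (K.size + 9 + 1)) := by
    refine Yields.ctx_range (fun i hi => Or.inr (Logic.infer hG.arith.logic 15 (by decide) (FregeSystem.sub [K, var (V.P L L i), var (cg a), var (oy L o i)])
      (θ := ctx K (eqv (V.P L L i) (oy L o i))) rfl (FregeSystem.prems_cons ?_ (FregeSystem.prems_cons (Or.inr (Or.inr rfl)) FregeSystem.prems_nil))))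
      fun i _ => (size_eqv _ _).le
    have h := ModMulU.One.mem_lines (L := L) (o := On L a) (K := K) (V := V) (c := cg a) (bA := b) hi
    rw [hOa i hi] at h
    exact Or.inr (Or.inl h)
  set A3 := A2 ∪ ctxSet K (eqW (V.P L L) (oy L o) L) with hA3
  -- congruence of `M'` with the multiplier of `o`: `c ≡ x₀`, `z ≡ xᵢ`
  have b4 : G.Yields (Γ ∪ A3) ({ctx K (neg (var (zg a)))} ∪ ctxSet K (eqW (oy L o) (oy L o) L) ∪ ctxSet K (eqW (on L o) (on L o) L)) (K.size + 10 + L * (K.size + 10) + L * (K.size + 10)) :=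
    (((Yields.single (Logic.infer hG.arith.logic 11 (by decide) (FregeSystem.sub [K, var (zg a)]) (θ := ctx K (neg (var (zg a)))) rfl
      (FregeSystem.prems_cons (hΓ hz) FregeSystem.prems_nil))).mono_size (by simp [ctx, size])).union (Yields.eqW_refl hG.arith.adder K (oy L o) L)).union
      (Yields.eqW_refl hG.arith.adder K (on L o) L)
  set A4 := A3 ∪ ({ctx K (neg (var (zg a)))} ∪ ctxSet K (eqW (oy L o) (oy L o) L) ∪ ctxSet K (eqW (on L o) (on L o) L)) with hA4
  have b5 : G.Yields (Γ ∪ A4) (ctxSet K (eqW V.a (ox o) L)) (L * (K.size + 9 + 1)) := by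
    refine Yields.ctx_range (fun i hi => Or.inr ?_) fun i _ => (size_eqv _ _).le
    by_cases h0 : i = 0
    · subst h0
      have hx0 := holds_litW_iff.1 hx 0 hL; simp only [lit, decide_true] at hx0
      refine Logic.infer hG.arith.logic 9 (by decide) (FregeSystem.sub [K, var (V.a 0), var (ox o 0)]) (θ := ctx K (eqv (V.a 0) (ox o 0))) rfl
        (FregeSystem.prems_cons ?_ (FregeSystem.prems_cons (hΓ hx0) FregeSystem.prems_nil))
      show ctx K (var ((Mp L a).inp 0)) ∈ _; rw [hMa 0 hL, if_pos rfl]; exact Or.inr (Or.inl (Or.inl (Or.inr rfl)))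
    · have hxi := holds_litW_iff.1 hx i hi; simp only [lit, h0, decide_false] at hxi
      refine Logic.infer hG.arith.logic 10 (by decide) (FregeSystem.sub [K, var (V.a i), var (ox o i)]) (θ := ctx K (eqv (V.a i) (ox o i))) rfl
        (FregeSystem.prems_cons ?_ (FregeSystem.prems_cons (hΓ hxi) FregeSystem.prems_nil))
      show ctx K (neg (var ((Mp L a).inp i))) ∈ _; rw [hMa i hi, if_neg h0]; exact Or.inr (Or.inr (Or.inl (Or.inl rfl)))
  set A5 := A4 ∪ ctxSet K (eqW V.a (ox o) L) with hA5
  set d : ModMulU.PairData := ⟨V, ModMulU.viewOf o L, L⟩ with hd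
  have b6 : G.Yields (Γ ∪ A5) {χ | χ ∈ d.lines K} ((K.size + 10) + L * ((13 * L + 4) * (K.size + 10))) :=
    Yields.of_isBlock (d.isBlock_lines hG.arith.netlist hG.arith.logic (hVA.mono hΓ) (hR.hV.mono hΓ) (fun i hi => Or.inr (Or.inr (mem_ctxSet (mem_eqW hi))))
      (fun i hi => by show ctx K (eqv ((Mp L a).inp (L + i)) (o.inp (L + i))) ∈ _; rw [hMb i hi]; exact Or.inr (Or.inl (Or.inr (Or.inl (Or.inr (mem_ctxSet (mem_eqW hi)))))))
      fun i hi => by show ctx K (eqv ((Mp L a).inp (2 * L + i)) (o.inp (2 * L + i))) ∈ _; rw [hMn i hi]; exact Or.inr (Or.inl (Or.inr (Or.inr (mem_ctxSet (mem_eqW hi))))))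
      subset_rfl d.proofSize_lines
  set A6 := A5 ∪ {χ | χ ∈ d.lines K} with hA6
  -- `res o = P_L(o) ≡ P_L(M') ≡ y`
  have hpair : Holds K (Γ ∪ A6) (eqW (V.P L L) (fun i => o.base + resOff L i) L) := holds_eqW_iff.2 fun i hi => by
    have h := d.mem_lines (K := K) hi; simp only [hd, ModMulU.View.out, P_eq hL] at h; exact Or.inr (Or.inr h)
  have b7 := Yields.eqW_symm hG.arith.logic hpair
  set A7 := A6 ∪ ctxSet K (eqW (fun i => o.base + resOff L i) (V.P L L) L) with hA7
  have b8 := Yields.eqW_trans hG.arith.logic (K := K) (Γ := Γ ∪ A7) (a := fun i => o.base + resOff L i) (b := V.P L L) (d := oy L o) (W := L)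
    (holds_ctxSet fun θ hθ => Or.inr (Or.inr hθ)) (holds_ctxSet fun θ hθ => Or.inr (Or.inl (Or.inl (Or.inl (Or.inl (Or.inr hθ))))))
  have h := ((((((b1.trans b2).trans b3).trans b4).trans b5).trans b6).trans b7).trans b8
  refine (h.mono_right fun θ hθ => Or.inr hθ).mono_size ?_
  simp only [unitC]
  have hP : L ≤ (L + 1) * (L + 1) := by nlinarith
  have hK : K.size + 10 ≤ K.size + 100 := by omega
  have t1 : (18 * L * L + 8 * L + 2) * (K.size + 100) ≤ (18 * ((L + 1) * (L + 1))) * (K.size + 100) := Nat.mul_le_mul_right _ (by nlinarith)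
  have t2 : K.size + 10 ≤ ((L + 1) * (L + 1)) * (K.size + 100) := by nlinarith
  have t3 : L * (K.size + 9 + 1) ≤ ((L + 1) * (L + 1)) * (K.size + 100) := Nat.mul_le_mul hP (by omega)
  have t4 : L * (K.size + 10) ≤ ((L + 1) * (L + 1)) * (K.size + 100) := Nat.mul_le_mul hP hK
  have t5 : L * ((13 * L + 4) * (K.size + 10)) ≤ (13 * ((L + 1) * (L + 1))) * (K.size + 100) := by
    rw [← Nat.mul_assoc]; exact Nat.mul_le_mul (by nlinarith) hK
  have e : 40 * (L + 1) * (L + 1) * (K.size + 100) = 40 * (((L + 1) * (L + 1)) * (K.size + 100)) := by ring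
  rw [e]; linarith

end MulKit

end Literature.Computability.MetaComplexity

/-!
# The operation kit of uniform modular multiplication, III: the medial law

`(x ∘ y) ∘ (z ∘ w) = (x ∘ z) ∘ (y ∘ w)` bitwise for `x, y, z, w < n`, for the kit of
`ModMulU.mulRT L` (`MulKit.medial`), from the associativity (`ModMulU.Assoc`), commutativity
(`ModMulU.Comm`) and congruence (`ModMulU.PairData`) of the uniform multiplier. The auxiliary
template `MulKit.medT L` (inputs `x, y, z, w, n, U = z ∘ w, V = y ∘ w`, `7L`) holds a zero gate
and the kits `assoc(x, y, U)`, `assoc(y, z, w)`, `comm(y, z)`, `assoc(z, y, w)`, `assoc(x, z, V)`.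
The chain of bitwise equalities:
`(x∘y)∘U ≡ x∘(y∘U)`, `y∘U ≡ y∘(z∘w) ≡ (y∘z)∘w ≡ (z∘y)∘w ≡ z∘(y∘w) ≡ z∘V`, so
`x∘(y∘U) ≡ x∘(z∘V) ≡ (x∘z)∘V`.

## Sources

* S. A. Cook, R. A. Reckhow, *The relative efficiency of propositional proof systems*,
  J. Symbolic Logic 44 (1979), §2.
* J. Krajíček, *Bounded Arithmetic, Propositional Logic, and Complexity Theory* (CUP 1995), §9.2.
-/

namespace Literature.Computability.MetaComplexity

open _root_.Computability Complexity Complexity.PropForm FregeSystem Netlist ModAdd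

namespace MulKit

variable (L : ℕ)

/-! ### The auxiliary template -/

/-- The zero gate. [folklore] -/
def zeroT : Template := [⟨Kind.cst false, []⟩]

/-- Wiring of `assoc(x, y, U)` (template inputs: `x` `0…`, `y` `L…`, `z` `2L…`, `w` `3L…`, `n` `4L…`,
`U` `5L…`, `V` `6L…`; kit inputs `a, b, c, n, z`). [folklore] -/
def w1 (i : ℕ) : ℕ ⊕ ℕ :=
  if i < 2 * L then Sum.inl i else if i < 3 * L then Sum.inl (5 * L + (i - 2 * L)) else if i < 4 * L then Sum.inl (4 * L + (i - 3 * L)) else Sum.inr 0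
/-- Wiring of `assoc(y, z, w)`. [folklore] -/
def w2 (i : ℕ) : ℕ ⊕ ℕ := if i < 4 * L then Sum.inl (L + i) else Sum.inr 0
/-- Wiring of `comm(y, z)` (kit inputs `a, b, n, z`). [folklore] -/
def w3 (i : ℕ) : ℕ ⊕ ℕ := if i < 2 * L then Sum.inl (L + i) else if i < 3 * L then Sum.inl (2 * L + i) else Sum.inr 0
/-- Wiring of `assoc(z, y, w)`. [folklore] -/
def w4 (i : ℕ) : ℕ ⊕ ℕ :=
  if i < L then Sum.inl (2 * L + i) else if i < 2 * L then Sum.inl (i - L + L) else if i < 4 * L then Sum.inl (L + i) else Sum.inr 0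
/-- Wiring of `assoc(x, z, V)`. [folklore] -/
def w5 (i : ℕ) : ℕ ⊕ ℕ :=
  if i < L then Sum.inl i else if i < 2 * L then Sum.inl (L + i) else if i < 3 * L then Sum.inl (4 * L + i) else if i < 4 * L then Sum.inl (L + i) else Sum.inr 0

/-- The pieces of the medial template. [folklore] -/
def mPieces : ℕ → Piece
  | 0 => ⟨zeroT, 0, Sum.inl⟩
  | 1 => ⟨ModMulU.Assoc.assocT L, 4 * L + 1, w1 L⟩
  | 2 => ⟨ModMulU.Assoc.assocT L, 4 * L + 1, w2 L⟩
  | 3 => ⟨ModMulU.Comm.commT L, 3 * L + 1, w3 L⟩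
  | 4 => ⟨ModMulU.Assoc.assocT L, 4 * L + 1, w4 L⟩
  | _ => ⟨ModMulU.Assoc.assocT L, 4 * L + 1, w5 L⟩

/-- **The medial template.** [folklore] -/
def medT : Template := layout (mPieces L) 6

variable {L}

/-- The pieces are well formed and well wired (`7L` inputs). [cite: Vollmer1999, Def. 1.6] -/
theorem mPiece_ok (hL : 0 < L) : ∀ k < 6, Piece.OK (mPieces L) (7 * L) k := by
  intro k hk
  have hpos : ∀ k, 0 < k → 0 < offset (mPieces L) k := fun k hk => by
    obtain ⟨k, rfl⟩ : ∃ k', k = k' + 1 := ⟨k - 1, by omega⟩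
    induction k with
    | zero => rw [offset_succ, offset_zero]; simp [mPieces, zeroT]
    | succ k ih => rw [offset_succ]; exact Nat.lt_of_lt_of_le (ih (by omega)) (Nat.le_add_right _ _)
  have hk6 : k = 0 ∨ k = 1 ∨ k = 2 ∨ k = 3 ∨ k = 4 ∨ k = 5 := by omega
  rcases hk6 with rfl | rfl | rfl | rfl | rfl | rfl
  · refine ⟨fun g hg => ?_, fun i hi => absurd hi (Nat.not_lt_zero i)⟩
    have hg0 : g = 0 := by simpa [mPieces, zeroT] using hg
    subst hg0; exact ⟨rfl, fun a ha => by simp [mPieces, zeroT] at ha⟩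
  · refine ⟨ModMulU.Assoc.wf_assocT L hL, fun i hi => ?_⟩
    show (∀ a, w1 L i = Sum.inl a → a < 7 * L) ∧ ∀ g, w1 L i = Sum.inr g → g < offset (mPieces L) 1
    change i < 4 * L + 1 at hi
    unfold w1; split_ifs <;> exact ⟨fun a ha => (by cases ha <;> omega), fun g hg => (by cases hg <;> exact hpos 1 Nat.one_pos)⟩
  · refine ⟨ModMulU.Assoc.wf_assocT L hL, fun i hi => ?_⟩
    show (∀ a, w2 L i = Sum.inl a → a < 7 * L) ∧ ∀ g, w2 L i = Sum.inr g → g < offset (mPieces L) 2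
    change i < 4 * L + 1 at hi
    unfold w2; split_ifs <;> exact ⟨fun a ha => (by cases ha <;> omega), fun g hg => (by cases hg <;> exact hpos 2 (by omega))⟩
  · refine ⟨ModMulU.Comm.wf_commT L hL, fun i hi => ?_⟩
    show (∀ a, w3 L i = Sum.inl a → a < 7 * L) ∧ ∀ g, w3 L i = Sum.inr g → g < offset (mPieces L) 3
    change i < 3 * L + 1 at hi
    unfold w3; split_ifs <;> exact ⟨fun a ha => (by cases ha <;> omega), fun g hg => (by cases hg <;> exact hpos 3 (by omega))⟩
  · refine ⟨ModMulU.Assoc.wf_assocT L hL, fun i hi => ?_⟩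
    show (∀ a, w4 L i = Sum.inl a → a < 7 * L) ∧ ∀ g, w4 L i = Sum.inr g → g < offset (mPieces L) 4
    change i < 4 * L + 1 at hi
    unfold w4; split_ifs <;> exact ⟨fun a ha => (by cases ha <;> omega), fun g hg => (by cases hg <;> exact hpos 4 (by omega))⟩
  · refine ⟨ModMulU.Assoc.wf_assocT L hL, fun i hi => ?_⟩
    show (∀ a, w5 L i = Sum.inl a → a < 7 * L) ∧ ∀ g, w5 L i = Sum.inr g → g < offset (mPieces L) 5
    change i < 4 * L + 1 at hi
    unfold w5; split_ifs <;> exact ⟨fun a ha => (by cases ha <;> omega), fun g hg => (by cases hg <;> exact hpos 5 (by omega))⟩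

/-- **The medial template is well formed** (`7L` inputs). [cite: Vollmer1999, Def. 1.6] -/
theorem wf_medT (hL : 0 < L) : (medT L).WF (7 * L) := wf_layout (mPieces L) (mPiece_ok hL)

variable (L)

/-- The sources of the medial template among the six occurrences. [folklore] -/
def medSrc (q : ℕ) : Src :=
  if q < 2 * L then Src.inp 0 q else if q < 4 * L then Src.inp 1 (q - 2 * L) else if q < 5 * L then Src.inp 0 (q - 2 * L)
  else if q < 6 * L then Src.gate 1 (resOff L (q - 5 * L)) else Src.gate 4 (resOff L (q - 6 * L))

variable {L}

/-- The sources are in range (`L ≥ 1`). [folklore] -/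
theorem medSrc_ok (hL : 0 < L) (q : ℕ) (hq : q < 7 * L) : (medSrc L q).OK 6 (3 * L) (ModMulU.mulRT L).length := by
  unfold medSrc; split_ifs
  · exact ⟨by omega, by omega⟩
  · exact ⟨by omega, by omega⟩
  · exact ⟨by omega, by omega⟩
  · exact ⟨by omega, resOff_lt hL (by omega)⟩
  · exact ⟨by omega, resOff_lt hL (by omega)⟩

variable (L)

/-- The medial auxiliary. [folklore] -/
def medA : LawAux := ⟨medT L, 7 * L, medSrc L⟩

/-! ### The occurrences inside the auxiliary -/

section Inside

variable (a : Occ) {os : ℕ → Occ}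

/-- The kits. [folklore] -/
def Pk (k : ℕ) : Occ := pieceOcc (a.inst (7 * L)) (mPieces L) k
/-- The zero gate. [folklore] -/
def zz : ℕ := a.base

variable {L a}

/-- The values read through the sources: the seven words. [folklore] -/
theorem src_vals (hw : AuxWired (7 * L) (medSrc L) os a) :
    (∀ i < L, a.inp i = (os 0).inp i) ∧ (∀ i < L, a.inp (L + i) = (os 0).inp (L + i)) ∧ (∀ i < L, a.inp (2 * L + i) = (os 1).inp i) ∧
      (∀ i < L, a.inp (3 * L + i) = (os 1).inp (L + i)) ∧ (∀ i < L, a.inp (4 * L + i) = (os 0).inp (2 * L + i)) ∧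
      (∀ i < L, a.inp (5 * L + i) = (os 1).base + resOff L i) ∧ ∀ i < L, a.inp (6 * L + i) = (os 4).base + resOff L i := by
  refine ⟨fun i hi => ?_, fun i hi => ?_, fun i hi => ?_, fun i hi => ?_, fun i hi => ?_, fun i hi => ?_, fun i hi => ?_⟩
  · rw [hw i (by omega)]; unfold medSrc; rw [if_pos (by omega)]; rfl
  · rw [hw (L + i) (by omega)]; unfold medSrc; rw [if_pos (by omega)]; rfl
  · rw [hw (2 * L + i) (by omega)]; unfold medSrc; rw [if_neg (by omega), if_pos (by omega), Nat.add_sub_cancel_left]; rfl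
  · rw [hw (3 * L + i) (by omega)]; unfold medSrc; rw [if_neg (by omega), if_pos (by omega), show 3 * L + i - 2 * L = L + i by omega]; rfl
  · rw [hw (4 * L + i) (by omega)]; unfold medSrc; rw [if_neg (by omega), if_neg (by omega), if_pos (by omega), show 4 * L + i - 2 * L = 2 * L + i by omega]; rfl
  · rw [hw (5 * L + i) (by omega)]; unfold medSrc; rw [if_neg (by omega), if_neg (by omega), if_neg (by omega), if_pos (by omega), Nat.add_sub_cancel_left]; rfl
  · rw [hw (6 * L + i) (by omega)]; unfold medSrc
    rw [if_neg (by omega), if_neg (by omega), if_neg (by omega), if_neg (by omega), Nat.add_sub_cancel_left]; rfl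

/-- An input wired to template input `q < 7L` reads `a.inp q`; wired to the zero gate reads `zz`. [folklore] -/
theorem ref_inl' {q : ℕ} (hq : q < 7 * L) : (a.inst (7 * L)).ref (Sum.inl q) = a.inp q := Occ.ref_inl _ hq

/-- The zero gate reference. [folklore] -/
theorem ref_zero : (a.inst (7 * L)).ref (Sum.inr 0) = zz a := by simp [Inst.ref, Inst.wire, zz]

/-- **The operands of the five kits** in terms of the seven words. [folklore] -/
theorem kit_inps (hw : AuxWired (7 * L) (medSrc L) os a) :
    (∀ i < L, ModMulU.Assoc.av (Pk L a 1) i = (os 0).inp i ∧ ModMulU.Assoc.bv L (Pk L a 1) i = (os 0).inp (L + i) ∧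
        ModMulU.Assoc.Cw L (Pk L a 1) 0 i = (os 1).base + resOff L i ∧ ModMulU.Assoc.nv L (Pk L a 1) i = (os 0).inp (2 * L + i)) ∧
    (∀ i < L, ModMulU.Assoc.av (Pk L a 2) i = (os 0).inp (L + i) ∧ ModMulU.Assoc.bv L (Pk L a 2) i = (os 1).inp i ∧
        ModMulU.Assoc.Cw L (Pk L a 2) 0 i = (os 1).inp (L + i) ∧ ModMulU.Assoc.nv L (Pk L a 2) i = (os 0).inp (2 * L + i)) ∧
    (∀ i < L, ModMulU.Comm.av (Pk L a 3) i = (os 0).inp (L + i) ∧ ModMulU.Comm.bv L (Pk L a 3) i = (os 1).inp i ∧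
        ModMulU.Comm.Bw L (Pk L a 3) 0 i = (os 1).inp i ∧ ModMulU.Comm.nv L (Pk L a 3) i = (os 0).inp (2 * L + i)) ∧
    (∀ i < L, ModMulU.Assoc.av (Pk L a 4) i = (os 1).inp i ∧ ModMulU.Assoc.bv L (Pk L a 4) i = (os 0).inp (L + i) ∧
        ModMulU.Assoc.Cw L (Pk L a 4) 0 i = (os 1).inp (L + i) ∧ ModMulU.Assoc.nv L (Pk L a 4) i = (os 0).inp (2 * L + i)) ∧
    (∀ i < L, ModMulU.Assoc.av (Pk L a 5) i = (os 0).inp i ∧ ModMulU.Assoc.bv L (Pk L a 5) i = (os 1).inp i ∧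
        ModMulU.Assoc.Cw L (Pk L a 5) 0 i = (os 4).base + resOff L i ∧ ModMulU.Assoc.nv L (Pk L a 5) i = (os 0).inp (2 * L + i)) ∧
    ModMulU.Assoc.zv L (Pk L a 1) = zz a ∧ ModMulU.Assoc.zv L (Pk L a 2) = zz a ∧ ModMulU.Comm.zv L (Pk L a 3) = zz a ∧
      ModMulU.Assoc.zv L (Pk L a 4) = zz a ∧ ModMulU.Assoc.zv L (Pk L a 5) = zz a := by
  obtain ⟨vx, vy, vz, vw, vn, vU, vV⟩ := src_vals hw
  have e : ∀ k i, (Pk L a k).inp i = (a.inst (7 * L)).ref ((mPieces L k).wire i) := fun k i => rfl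
  refine ⟨fun i hi => ?_, fun i hi => ?_, fun i hi => ?_, fun i hi => ?_, fun i hi => ?_, ?_, ?_, ?_, ?_, ?_⟩
  · simp only [ModMulU.Assoc.av, ModMulU.Assoc.bv, ModMulU.Assoc.Cw, ModMulU.Assoc.nv, Nat.add_zero, if_pos hi, e]
    refine ⟨?_, ?_, ?_, ?_⟩
    · show (a.inst (7 * L)).ref (w1 L i) = _; unfold w1; rw [if_pos (by omega), ref_inl' (by omega), vx i hi]
    · show (a.inst (7 * L)).ref (w1 L (L + i)) = _; unfold w1; rw [if_pos (by omega), ref_inl' (by omega), vy i hi]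
    · show (a.inst (7 * L)).ref (w1 L (2 * L + i)) = _; unfold w1
      rw [if_neg (by omega), if_pos (by omega), show 5 * L + (2 * L + i - 2 * L) = 5 * L + i by omega, ref_inl' (by omega), vU i hi]
    · show (a.inst (7 * L)).ref (w1 L (3 * L + i)) = _; unfold w1
      rw [if_neg (by omega), if_neg (by omega), if_pos (by omega), show 4 * L + (3 * L + i - 3 * L) = 4 * L + i by omega, ref_inl' (by omega), vn i hi]
  · simp only [ModMulU.Assoc.av, ModMulU.Assoc.bv, ModMulU.Assoc.Cw, ModMulU.Assoc.nv, Nat.add_zero, if_pos hi, e]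
    refine ⟨?_, ?_, ?_, ?_⟩
    · show (a.inst (7 * L)).ref (w2 L i) = _; unfold w2; rw [if_pos (by omega), ref_inl' (by omega), vy i hi]
    · show (a.inst (7 * L)).ref (w2 L (L + i)) = _; unfold w2; rw [if_pos (by omega), show L + (L + i) = 2 * L + i by ring, ref_inl' (by omega), vz i hi]
    · show (a.inst (7 * L)).ref (w2 L (2 * L + i)) = _; unfold w2; rw [if_pos (by omega), show L + (2 * L + i) = 3 * L + i by ring, ref_inl' (by omega), vw i hi]
    · show (a.inst (7 * L)).ref (w2 L (3 * L + i)) = _; unfold w2; rw [if_pos (by omega), show L + (3 * L + i) = 4 * L + i by ring, ref_inl' (by omega), vn i hi]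
  · simp only [ModMulU.Comm.av, ModMulU.Comm.bv, ModMulU.Comm.Bw, ModMulU.Comm.nv, Nat.add_zero, if_pos hi, e]
    refine ⟨?_, ?_, ?_, ?_⟩
    · show (a.inst (7 * L)).ref (w3 L i) = _; unfold w3; rw [if_pos (by omega), ref_inl' (by omega), vy i hi]
    · show (a.inst (7 * L)).ref (w3 L (L + i)) = _; unfold w3; rw [if_pos (by omega), show L + (L + i) = 2 * L + i by ring, ref_inl' (by omega), vz i hi]
    · show (a.inst (7 * L)).ref (w3 L (L + i)) = _; unfold w3; rw [if_pos (by omega), show L + (L + i) = 2 * L + i by ring, ref_inl' (by omega), vz i hi]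
    · show (a.inst (7 * L)).ref (w3 L (2 * L + i)) = _; unfold w3
      rw [if_neg (by omega), if_pos (by omega), show 2 * L + (2 * L + i) = 4 * L + i by ring, ref_inl' (by omega), vn i hi]
  · simp only [ModMulU.Assoc.av, ModMulU.Assoc.bv, ModMulU.Assoc.Cw, ModMulU.Assoc.nv, Nat.add_zero, if_pos hi, e]
    refine ⟨?_, ?_, ?_, ?_⟩
    · show (a.inst (7 * L)).ref (w4 L i) = _; unfold w4; rw [if_pos hi, ref_inl' (by omega), vz i hi]
    · show (a.inst (7 * L)).ref (w4 L (L + i)) = _; unfold w4; rw [if_neg (by omega), if_pos (by omega), show L + i - L + L = L + i by omega, ref_inl' (by omega), vy i hi]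
    · show (a.inst (7 * L)).ref (w4 L (2 * L + i)) = _; unfold w4
      rw [if_neg (by omega), if_neg (by omega), if_pos (by omega), show L + (2 * L + i) = 3 * L + i by ring, ref_inl' (by omega), vw i hi]
    · show (a.inst (7 * L)).ref (w4 L (3 * L + i)) = _; unfold w4
      rw [if_neg (by omega), if_neg (by omega), if_pos (by omega), show L + (3 * L + i) = 4 * L + i by ring, ref_inl' (by omega), vn i hi]
  · simp only [ModMulU.Assoc.av, ModMulU.Assoc.bv, ModMulU.Assoc.Cw, ModMulU.Assoc.nv, Nat.add_zero, if_pos hi, e]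
    refine ⟨?_, ?_, ?_, ?_⟩
    · show (a.inst (7 * L)).ref (w5 L i) = _; unfold w5; rw [if_pos hi, ref_inl' (by omega), vx i hi]
    · show (a.inst (7 * L)).ref (w5 L (L + i)) = _; unfold w5; rw [if_neg (by omega), if_pos (by omega), show L + (L + i) = 2 * L + i by ring, ref_inl' (by omega), vz i hi]
    · show (a.inst (7 * L)).ref (w5 L (2 * L + i)) = _; unfold w5
      rw [if_neg (by omega), if_neg (by omega), if_pos (by omega), show 4 * L + (2 * L + i) = 6 * L + i by ring, ref_inl' (by omega), vV i hi]
    · show (a.inst (7 * L)).ref (w5 L (3 * L + i)) = _; unfold w5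
      rw [if_neg (by omega), if_neg (by omega), if_neg (by omega), if_pos (by omega), show L + (3 * L + i) = 4 * L + i by ring, ref_inl' (by omega), vn i hi]
  · show (a.inst (7 * L)).ref (w1 L (4 * L)) = _; unfold w1; rw [if_neg (by omega), if_neg (by omega), if_neg (by omega)]; exact ref_zero
  · show (a.inst (7 * L)).ref (w2 L (4 * L)) = _; unfold w2; rw [if_neg (by omega)]; exact ref_zero
  · show (a.inst (7 * L)).ref (w3 L (3 * L)) = _; unfold w3; rw [if_neg (by omega), if_neg (by omega)]; exact ref_zero
  · show (a.inst (7 * L)).ref (w4 L (4 * L)) = _; unfold w4; rw [if_neg (by omega), if_neg (by omega), if_neg (by omega)]; exact ref_zero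
  · show (a.inst (7 * L)).ref (w5 L (4 * L)) = _; unfold w5; rw [if_neg (by omega), if_neg (by omega), if_neg (by omega), if_neg (by omega)]; exact ref_zero

/-- **The five kits and the zero gate are available** in an available auxiliary. [folklore] -/
theorem kits_avail (hL : 0 < L) {K : PropForm ℕ} {Γ : Set (PropForm ℕ)} (hA : a.Avail (medT L) (7 * L) K Γ) :
    ctx K (biimp (var (zz a)) (const false)) ∈ Γ ∧ ModMulU.Assoc.AAvail L (Pk L a 1) K Γ ∧ ModMulU.Assoc.AAvail L (Pk L a 2) K Γ ∧
      ModMulU.Comm.CAvail L (Pk L a 3) K Γ ∧ ModMulU.Assoc.AAvail L (Pk L a 4) K Γ ∧ ModMulU.Assoc.AAvail L (Pk L a 5) K Γ := by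
  have hI : (a.inst (7 * L)).DefsAvail (layout (mPieces L) 6) K Γ := hA
  have h0 : (Pk L a 0).Avail zeroT 0 K Γ := Inst.DefsAvail.piece hI (k := 0) (by omega) (mPiece_ok hL 0 (by omega)).1
  refine ⟨?_, ModMulU.Assoc.avail_ofOcc hL (Inst.DefsAvail.piece hI (k := 1) (by omega) (ModMulU.Assoc.wf_assocT L hL)),
    ModMulU.Assoc.avail_ofOcc hL (Inst.DefsAvail.piece hI (k := 2) (by omega) (ModMulU.Assoc.wf_assocT L hL)),
    ModMulU.Comm.avail_ofOcc hL (Inst.DefsAvail.piece hI (k := 3) (by omega) (ModMulU.Comm.wf_commT L hL)),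
    ModMulU.Assoc.avail_ofOcc hL (Inst.DefsAvail.piece hI (k := 4) (by omega) (ModMulU.Assoc.wf_assocT L hL)),
    ModMulU.Assoc.avail_ofOcc hL (Inst.DefsAvail.piece hI (k := 5) (by omega) (ModMulU.Assoc.wf_assocT L hL))⟩
  have h := h0 0 (by simp [zeroT]); simpa [zeroT, Inst.body, Kind.body, Pk, pieceOcc, offset_zero, Inst.wire, zz] using h

end Inside

/-! ### Phase T: transporting the range certificates to the kits -/

section Law

variable {L} {G : FregeSystem} {K : PropForm ℕ} {Γ : Set (PropForm ℕ)} {os : ℕ → Occ} {a : Occ}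

/-- The range literals of the kits. [folklore] -/
structure FactsT (L : ℕ) (a : Occ) (K : PropForm ℕ) (Γ' : Set (PropForm ℕ)) : Prop where
  /-- `assoc(x,y,U)`: `x < n`, `y < n` -/
  l1 : ctx K (neg (var ((ModMulU.Assoc.CmpA L (Pk L a 1)).ge L L))) ∈ Γ' ∧ ctx K (neg (var ((ModMulU.Assoc.CmpB L (Pk L a 1)).ge L L))) ∈ Γ'
  /-- `assoc(y,z,w)` -/
  l2 : ctx K (neg (var ((ModMulU.Assoc.CmpA L (Pk L a 2)).ge L L))) ∈ Γ' ∧ ctx K (neg (var ((ModMulU.Assoc.CmpB L (Pk L a 2)).ge L L))) ∈ Γ'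
  /-- `comm(y,z)` -/
  l3 : ctx K (neg (var ((ModMulU.Comm.CmpA L (Pk L a 3)).ge L L))) ∈ Γ' ∧ ctx K (neg (var ((ModMulU.Comm.CmpB L (Pk L a 3)).ge L L))) ∈ Γ'
  /-- `assoc(z,y,w)` -/
  l4 : ctx K (neg (var ((ModMulU.Assoc.CmpA L (Pk L a 4)).ge L L))) ∈ Γ' ∧ ctx K (neg (var ((ModMulU.Assoc.CmpB L (Pk L a 4)).ge L L))) ∈ Γ'
  /-- `assoc(x,z,V)` -/
  l5 : ctx K (neg (var ((ModMulU.Assoc.CmpA L (Pk L a 5)).ge L L))) ∈ Γ' ∧ ctx K (neg (var ((ModMulU.Assoc.CmpB L (Pk L a 5)).ge L L))) ∈ Γ'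

/-- Monotonicity. [folklore] -/
theorem FactsT.mono {Γ' Γ'' : Set (PropForm ℕ)} (h : FactsT L a K Γ') (hΓ : Γ' ⊆ Γ'') : FactsT L a K Γ'' :=
  ⟨⟨hΓ h.l1.1, hΓ h.l1.2⟩, ⟨hΓ h.l2.1, hΓ h.l2.2⟩, ⟨hΓ h.l3.1, hΓ h.l3.2⟩, ⟨hΓ h.l4.1, hΓ h.l4.2⟩, ⟨hΓ h.l5.1, hΓ h.l5.2⟩⟩

/-- One transport onto a comparator of a kit whose operands are (pointwise) a certified word and `n`. [folklore] -/
theorem transport1 (hG : MRules G) {x nw : ℕ → ℕ} {Γ' : Set (PropForm ℕ)} (hx : LtN L K Γ' x nw) (C : Sub.View) (hC : C.Avail K Γ' L)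
    (hCx : ∀ i < L, C.x i = x i) (hCy : ∀ i < L, C.y i = nw i) (hrx : Holds K Γ' (eqW x x L)) (hrn : Holds K Γ' (eqW nw nw L)) :
    G.Yields Γ' {ctx K (neg (var (C.ge L L)))} ((3 * L + 2) * (K.size + 10)) :=
  LtN.transport hG.arith.toRulesOK hx C hC le_rfl (fun i hi => by rw [hCx i hi]; exact holds_eqW_iff.1 hrx i hi) fun i hi => by
    rw [hCy i hi]; exact holds_eqW_iff.1 hrn i hi

/-- **Phase T.** [folklore] -/
theorem phaseT (hG : MRules G) (hL : 0 < L) (hA : a.Avail (medT L) (7 * L) K Γ) (hw : AuxWired (7 * L) (medSrc L) os a)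
    (hx : LtN L K Γ (ox (os 0)) (on L (os 0))) (hy : LtN L K Γ (oy L (os 0)) (on L (os 0))) (hz : LtN L K Γ (ox (os 1)) (on L (os 0))) :
    ∃ Δ : Set (PropForm ℕ), G.Yields Γ Δ (4 * (L * (K.size + 10)) + 10 * ((3 * L + 2) * (K.size + 10))) ∧ FactsT L a K (Γ ∪ Δ) := by
  have hΓ : ∀ {X : Set (PropForm ℕ)}, Γ ⊆ Γ ∪ X := fun {X} => Set.subset_union_left
  obtain ⟨-, a1, a2, a3, a4, a5⟩ := kits_avail hL hA
  obtain ⟨i1, i2, i3, i4, i5, -⟩ := kit_inps (L := L) (a := a) (os := os) hw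
  have b0 := (((Yields.eqW_refl hG.arith.adder K (ox (os 0)) L (Γ := Γ)).union (Yields.eqW_refl hG.arith.adder K (oy L (os 0)) L)).union
    (Yields.eqW_refl hG.arith.adder K (ox (os 1)) L)).union (Yields.eqW_refl hG.arith.adder K (on L (os 0)) L)
  set A0 := ctxSet K (eqW (ox (os 0)) (ox (os 0)) L) ∪ ctxSet K (eqW (oy L (os 0)) (oy L (os 0)) L) ∪ ctxSet K (eqW (ox (os 1)) (ox (os 1)) L) ∪
    ctxSet K (eqW (on L (os 0)) (on L (os 0)) L) with hA0
  have rx : Holds K (Γ ∪ A0) (eqW (ox (os 0)) (ox (os 0)) L) := holds_ctxSet fun θ hθ => Or.inr (Or.inl (Or.inl (Or.inl hθ)))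
  have ry : Holds K (Γ ∪ A0) (eqW (oy L (os 0)) (oy L (os 0)) L) := holds_ctxSet fun θ hθ => Or.inr (Or.inl (Or.inl (Or.inr hθ)))
  have rz : Holds K (Γ ∪ A0) (eqW (ox (os 1)) (ox (os 1)) L) := holds_ctxSet fun θ hθ => Or.inr (Or.inl (Or.inr hθ))
  have rn : Holds K (Γ ∪ A0) (eqW (on L (os 0)) (on L (os 0)) L) := holds_ctxSet fun θ hθ => Or.inr (Or.inr hθ)
  have t := fun {xw : ℕ → ℕ} (hxw : LtN L K Γ xw (on L (os 0))) (C : Sub.View) (hC : C.Avail K Γ L) (hCx : ∀ i < L, C.x i = xw i)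
      (hCy : ∀ i < L, C.y i = on L (os 0) i) (hr : Holds K (Γ ∪ A0) (eqW xw xw L)) =>
    transport1 hG (hxw.mono hΓ) C (hC.mono hΓ) hCx hCy hr rn
  have b1 := ((((((((t hx _ a1.hA (fun i hi => (i1 i hi).1) (fun i hi => (i1 i hi).2.2.2) rx).union
    (t hy _ a1.hB (fun i hi => (i1 i hi).2.1) (fun i hi => (i1 i hi).2.2.2) ry)).union
    (t hy _ a2.hA (fun i hi => (i2 i hi).1) (fun i hi => (i2 i hi).2.2.2) ry)).union
    (t hz _ a2.hB (fun i hi => (i2 i hi).2.1) (fun i hi => (i2 i hi).2.2.2) rz)).union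
    (t hy _ a3.hA (fun i hi => (i3 i hi).1) (fun i hi => (i3 i hi).2.2.2) ry)).union
    (t hz _ a3.hB (fun i hi => (i3 i hi).2.1) (fun i hi => (i3 i hi).2.2.2) rz)).union
    (t hz _ a4.hA (fun i hi => (i4 i hi).1) (fun i hi => (i4 i hi).2.2.2) rz)).union
    (t hy _ a4.hB (fun i hi => (i4 i hi).2.1) (fun i hi => (i4 i hi).2.2.2) ry)).union
    ((t hx _ a5.hA (fun i hi => (i5 i hi).1) (fun i hi => (i5 i hi).2.2.2) rx).union
    (t hz _ a5.hB (fun i hi => (i5 i hi).2.1) (fun i hi => (i5 i hi).2.2.2) rz))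
  have h := b0.trans b1
  refine ⟨_, h.mono_size (by nlinarith [Nat.zero_le K.size, Nat.zero_le L]), ?_⟩
  exact ⟨⟨Or.inr (Or.inr (Or.inl (Or.inl (Or.inl (Or.inl (Or.inl (Or.inl (Or.inl (Or.inl (rfl)))))))))), Or.inr (Or.inr (Or.inl (Or.inl (Or.inl (Or.inl (Or.inl (Or.inl (Or.inl (Or.inr rfl)))))))))⟩, ⟨Or.inr (Or.inr (Or.inl (Or.inl (Or.inl (Or.inl (Or.inl (Or.inl (Or.inr rfl)))))))), Or.inr (Or.inr (Or.inl (Or.inl (Or.inl (Or.inl (Or.inl (Or.inr rfl)))))))⟩, ⟨Or.inr (Or.inr (Or.inl (Or.inl (Or.inl (Or.inl (Or.inr rfl)))))), Or.inr (Or.inr (Or.inl (Or.inl (Or.inl (Or.inr rfl)))))⟩, ⟨Or.inr (Or.inr (Or.inl (Or.inl (Or.inr rfl)))), Or.inr (Or.inr (Or.inl (Or.inr rfl)))⟩, ⟨Or.inr (Or.inr (Or.inr (Or.inl rfl))), Or.inr (Or.inr (Or.inr (Or.inr rfl)))⟩⟩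

/-! ### Phase L: the five laws -/

/-- The conclusions of the five laws. [folklore] -/
structure FactsL (L : ℕ) (a : Occ) (K : PropForm ℕ) (Γ' : Set (PropForm ℕ)) : Prop where
  /-- `assoc(x,y,U)` -/
  e1 : Holds K Γ' (eqW ((ModMulU.Assoc.ABC L (Pk L a 1) L).P L L) ((ModMulU.Assoc.LHS L (Pk L a 1) L).P L L) L)
  /-- `assoc(y,z,w)` -/
  e2 : Holds K Γ' (eqW ((ModMulU.Assoc.ABC L (Pk L a 2) L).P L L) ((ModMulU.Assoc.LHS L (Pk L a 2) L).P L L) L)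
  /-- `comm(y,z)` -/
  e3 : Holds K Γ' (eqW ((ModMulU.Comm.M L (Pk L a 3) L).P L L) ((ModMulU.Comm.BA L (Pk L a 3)).P L L) L)
  /-- `assoc(z,y,w)` -/
  e4 : Holds K Γ' (eqW ((ModMulU.Assoc.ABC L (Pk L a 4) L).P L L) ((ModMulU.Assoc.LHS L (Pk L a 4) L).P L L) L)
  /-- `assoc(x,z,V)` -/
  e5 : Holds K Γ' (eqW ((ModMulU.Assoc.ABC L (Pk L a 5) L).P L L) ((ModMulU.Assoc.LHS L (Pk L a 5) L).P L L) L)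

/-- Monotonicity. [folklore] -/
theorem FactsL.mono {Γ' Γ'' : Set (PropForm ℕ)} (h : FactsL L a K Γ') (hΓ : Γ' ⊆ Γ'') : FactsL L a K Γ'' :=
  ⟨h.e1.mono hΓ, h.e2.mono hΓ, h.e3.mono hΓ, h.e4.mono hΓ, h.e5.mono hΓ⟩

/-- One associativity law as a `Yields`. [cite: Krajicek1995, §9.2] -/
theorem assoc1 (hG : MRules G) (hL : 0 < L) {m : ℕ} (hm : m + 2 ≤ L) {Γ' : Set (PropForm ℕ)} {o : Occ} (h : ModMulU.Assoc.AAvail L o K Γ')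
    (hzdef : ctx K (biimp (var (ModMulU.Assoc.zv L o)) (const false)) ∈ Γ') (hltA : ctx K (neg (var ((ModMulU.Assoc.CmpA L o).ge L L))) ∈ Γ')
    (hltB : ctx K (neg (var ((ModMulU.Assoc.CmpB L o).ge L L))) ∈ Γ') (hnh : ∀ i, m ≤ i → i < L → ctx K (neg (var (ModMulU.Assoc.nv L o i))) ∈ Γ') :
    G.Yields Γ' (ctxSet K (eqW ((ModMulU.Assoc.ABC L o L).P L L) ((ModMulU.Assoc.LHS L o L).P L L) L)) (171200 * ((L + 1) * (L + 1) * (L + 1) * (L + 1)) * (K.size + 153)) :=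
  ModMulU.Assoc.yields hG.comm hG.one hG.glue hG.sys hG.arith.netlist hG.arith.adder hG.arith.logic hG.assocU hG.modAddU hG.range hG.glueU hG.mask hG.maskMul
    hL h hm hzdef hltA hltB hnh

/-- The commutativity law as a `Yields`. [cite: Krajicek1995, §9.2] -/
theorem comm1 (hG : MRules G) (hL : 0 < L) {m : ℕ} (hm : m + 2 ≤ L) {Γ' : Set (PropForm ℕ)} {o : Occ} (h : ModMulU.Comm.CAvail L o K Γ')
    (hzdef : ctx K (biimp (var (ModMulU.Comm.zv L o)) (const false)) ∈ Γ') (hltA : ctx K (neg (var ((ModMulU.Comm.CmpA L o).ge L L))) ∈ Γ')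
    (hltB : ctx K (neg (var ((ModMulU.Comm.CmpB L o).ge L L))) ∈ Γ') (hnh : ∀ i, m ≤ i → i < L → ctx K (neg (var (ModMulU.Comm.nv L o i))) ∈ Γ') :
    G.Yields Γ' (ctxSet K (eqW ((ModMulU.Comm.M L o L).P L L) ((ModMulU.Comm.BA L o).P L L) L)) (24300 * ((L + 1) * (L + 1) * (L + 1)) * (K.size + 153)) := by
  refine Yields.of_isBlock (ModMulU.Comm.isBlock_lines hG.comm hG.one hG.glue hG.sys hG.arith.netlist hG.arith.adder hG.arith.logic hG.assocU hG.modAddU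
    hG.range hG.glueU hG.mask hL h hm hzdef hltA hltB hnh) ?_ (ModMulU.Comm.proofSize_lines hL o K m)
  rintro θ ⟨Lb, hLb, rfl⟩
  obtain ⟨i, hi, rfl⟩ := List.mem_map.1 hLb
  exact ModMulU.Comm.mem_lines hL (List.mem_range.1 hi)

/-- **Phase L.** [folklore] -/
theorem phaseL (hG : MRules G) (hL : 0 < L) {m : ℕ} (hm : m + 2 ≤ L) (hA : a.Avail (medT L) (7 * L) K Γ) (hw : AuxWired (7 * L) (medSrc L) os a)
    (hg : GlobW L m K Γ (on L (os 0))) (fT : FactsT L a K Γ) :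
    ∃ Δ : Set (PropForm ℕ), G.Yields Γ Δ (710000 * ((L + 1) * (L + 1) * (L + 1) * (L + 1)) * (K.size + 153)) ∧ FactsL L a K (Γ ∪ Δ) := by
  obtain ⟨hz, a1, a2, a3, a4, a5⟩ := kits_avail hL hA
  obtain ⟨i1, i2, i3, i4, i5, z1, z2, z3, z4, z5⟩ := kit_inps (L := L) (a := a) (os := os) hw
  have nh := hg.nhigh
  have b := ((((assoc1 hG hL hm a1 (by rw [z1]; exact hz) fT.l1.1 fT.l1.2 fun i h1 h2 => by rw [(i1 i h2).2.2.2]; exact nh i h1 h2).union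
    (assoc1 hG hL hm a2 (by rw [z2]; exact hz) fT.l2.1 fT.l2.2 fun i h1 h2 => by rw [(i2 i h2).2.2.2]; exact nh i h1 h2)).union
    (comm1 hG hL hm a3 (by rw [z3]; exact hz) fT.l3.1 fT.l3.2 fun i h1 h2 => by rw [(i3 i h2).2.2.2]; exact nh i h1 h2)).union
    (assoc1 hG hL hm a4 (by rw [z4]; exact hz) fT.l4.1 fT.l4.2 fun i h1 h2 => by rw [(i4 i h2).2.2.2]; exact nh i h1 h2)).union
    (assoc1 hG hL hm a5 (by rw [z5]; exact hz) fT.l5.1 fT.l5.2 fun i h1 h2 => by rw [(i5 i h2).2.2.2]; exact nh i h1 h2)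
  refine ⟨_, b.mono_size ?_, ⟨holds_ctxSet fun θ hθ => Or.inr (Or.inl (Or.inl (Or.inl (Or.inl hθ)))), holds_ctxSet fun θ hθ => Or.inr (Or.inl (Or.inl (Or.inl (Or.inr hθ)))),
    holds_ctxSet fun θ hθ => Or.inr (Or.inl (Or.inl (Or.inr hθ))), holds_ctxSet fun θ hθ => Or.inr (Or.inl (Or.inr hθ)), holds_ctxSet fun θ hθ => Or.inr (Or.inr hθ)⟩⟩
  have : (L + 1) * (L + 1) * (L + 1) ≤ (L + 1) * (L + 1) * (L + 1) * (L + 1) := Nat.le_mul_of_pos_right _ (Nat.succ_pos L)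
  nlinarith [Nat.zero_le ((L + 1) * (L + 1) * (L + 1) * (L + 1) * (K.size + 153))]

/-! ### Phase P: congruences -/

/-- The result word of an occurrence. [folklore] -/
abbrev rw' (L : ℕ) (o : Occ) : ℕ → ℕ := fun i => o.base + resOff L i

/-- **Congruence of two multipliers** as a `Yields` (the library's `PairData`). [cite: CookReckhow1979, §2] -/
theorem pairP (hG : MRules G) {Γ' : Set (PropForm ℕ)} (V₁ V₂ : ModMulU.View) (h₁ : V₁.Avail L K Γ') (h₂ : V₂.Avail L K Γ')
    (ha : ∀ i < L, ctx K (eqv (V₁.a i) (V₂.a i)) ∈ Γ') (hb : ∀ i < L, ctx K (eqv (V₁.b i) (V₂.b i)) ∈ Γ') (hn : ∀ i < L, ctx K (eqv (V₁.n i) (V₂.n i)) ∈ Γ') :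
    G.Yields Γ' (ctxSet K (eqW (V₁.P L L) (V₂.P L L) L)) ((K.size + 10) + L * ((13 * L + 4) * (K.size + 10))) := by
  set d : ModMulU.PairData := ⟨V₁, V₂, L⟩ with hd
  refine Yields.of_isBlock (d.isBlock_lines hG.arith.netlist hG.arith.logic h₁ h₂ ha hb hn) ?_ d.proofSize_lines
  rintro θ ⟨Lb, hLb, rfl⟩
  obtain ⟨i, hi, rfl⟩ := List.mem_map.1 hLb
  exact d.mem_lines (K := K) (List.mem_range.1 hi)

/-- The facts of the first congruence phase. [folklore] -/
structure FactsP (L : ℕ) (a : Occ) (os : ℕ → Occ) (K : PropForm ℕ) (Γ' : Set (PropForm ℕ)) : Prop where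
  /-- reflexivity lines of the seven words -/
  rx : Holds K Γ' (eqW (ox (os 0)) (ox (os 0)) L)
  /-- `y` -/
  ry : Holds K Γ' (eqW (oy L (os 0)) (oy L (os 0)) L)
  /-- `z` -/
  rz : Holds K Γ' (eqW (ox (os 1)) (ox (os 1)) L)
  /-- `w` -/
  rw : Holds K Γ' (eqW (oy L (os 1)) (oy L (os 1)) L)
  /-- `n` -/
  rn : Holds K Γ' (eqW (on L (os 0)) (on L (os 0)) L)
  /-- `U = res (os 1)` -/
  rU : Holds K Γ' (eqW (rw' L (os 1)) (rw' L (os 1)) L)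
  /-- `V = res (os 4)` -/
  rV : Holds K Γ' (eqW (rw' L (os 4)) (rw' L (os 4)) L)
  /-- `res (os 0) ≡ P(AB₁)` -/
  p1 : Holds K Γ' (eqW (rw' L (os 0)) ((ModMulU.Assoc.AB L (Pk L a 1)).P L L) L)
  /-- `res (os 2) ≡ P(LHS₁)` -/
  p2 : Holds K Γ' (eqW (rw' L (os 2)) ((ModMulU.Assoc.LHS L (Pk L a 1) L).P L L) L)
  /-- `P(BC₂) ≡ res (os 1)` -/
  p3 : Holds K Γ' (eqW ((ModMulU.Assoc.BC L (Pk L a 2) L).P L L) (rw' L (os 1)) L)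
  /-- `P(AB₂) ≡ P(M₃)` -/
  p5 : Holds K Γ' (eqW ((ModMulU.Assoc.AB L (Pk L a 2)).P L L) ((ModMulU.Comm.M L (Pk L a 3) L).P L L) L)
  /-- `P(BA₃) ≡ P(AB₄)` -/
  p6 : Holds K Γ' (eqW ((ModMulU.Comm.BA L (Pk L a 3)).P L L) ((ModMulU.Assoc.AB L (Pk L a 4)).P L L) L)
  /-- `P(BC₄) ≡ res (os 4)` -/
  p8 : Holds K Γ' (eqW ((ModMulU.Assoc.BC L (Pk L a 4) L).P L L) (rw' L (os 4)) L)
  /-- `P(AB₅) ≡ res (os 3)` -/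
  p10 : Holds K Γ' (eqW ((ModMulU.Assoc.AB L (Pk L a 5)).P L L) (rw' L (os 3)) L)
  /-- `P(LHS₅) ≡ res (os 5)` -/
  p11 : Holds K Γ' (eqW ((ModMulU.Assoc.LHS L (Pk L a 5) L).P L L) (rw' L (os 5)) L)

/-- Size of a congruence. [folklore] -/
def pdSize (L Ks : ℕ) : ℕ := (Ks + 10) + L * ((13 * L + 4) * (Ks + 10))

/-- Converting the output conclusion for a view of an occurrence. [folklore] -/
theorem holds_viewP (hL : 0 < L) {Γ' : Set (PropForm ℕ)} {u : ℕ → ℕ} {o : Occ} (h : Holds K Γ' (eqW u ((ModMulU.viewOf o L).P L L) L)) :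
    Holds K Γ' (eqW u (rw' L o) L) := holds_eqW_iff.2 fun i hi => by rw [show rw' L o i = (ModMulU.viewOf o L).P L L i from (P_eq hL o i).symm]; exact holds_eqW_iff.1 h i hi

/-- Converting the output conclusion for a view of an occurrence (left). [folklore] -/
theorem holds_viewP' (hL : 0 < L) {Γ' : Set (PropForm ℕ)} {u : ℕ → ℕ} {o : Occ} (h : Holds K Γ' (eqW ((ModMulU.viewOf o L).P L L) u L)) :
    Holds K Γ' (eqW (rw' L o) u L) := holds_eqW_iff.2 fun i hi => by rw [show rw' L o i = (ModMulU.viewOf o L).P L L i from (P_eq hL o i).symm]; exact holds_eqW_iff.1 h i hi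

/-- **Phase P.** [folklore] -/
theorem phaseP (hG : MRules G) (hL : 0 < L) (hos : ∀ j < 6, (os j).Avail (ModMulU.mulRT L) (3 * L) K Γ) (sh : MShape L (fun o i => o.base + resOff L i) os)
    (hA : a.Avail (medT L) (7 * L) K Γ) (hw : AuxWired (7 * L) (medSrc L) os a) :
    ∃ Δ : Set (PropForm ℕ), G.Yields Γ Δ (7 * (L * (K.size + 10)) + 8 * pdSize L K.size) ∧ FactsP L a os K (Γ ∪ Δ) := by
  have hΓ : ∀ {X : Set (PropForm ℕ)}, Γ ⊆ Γ ∪ X := fun {X} => Set.subset_union_left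
  obtain ⟨-, a1, a2, a3, a4, a5⟩ := kits_avail hL hA
  obtain ⟨i1, i2, i3, i4, i5, -⟩ := kit_inps (L := L) (a := a) (os := os) hw
  have v := fun j (hj : j < 6) => (ModMulU.ravail_ofOcc (hos j hj)).hV
  -- reflexivity of the seven words
  have b0 := ((((((Yields.eqW_refl hG.arith.adder K (ox (os 0)) L (Γ := Γ)).union (Yields.eqW_refl hG.arith.adder K (oy L (os 0)) L)).union
    (Yields.eqW_refl hG.arith.adder K (ox (os 1)) L)).union (Yields.eqW_refl hG.arith.adder K (oy L (os 1)) L)).union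
    (Yields.eqW_refl hG.arith.adder K (on L (os 0)) L)).union (Yields.eqW_refl hG.arith.adder K (rw' L (os 1)) L)).union
    (Yields.eqW_refl hG.arith.adder K (rw' L (os 4)) L)
  set A0 := ctxSet K (eqW (ox (os 0)) (ox (os 0)) L) ∪ ctxSet K (eqW (oy L (os 0)) (oy L (os 0)) L) ∪ ctxSet K (eqW (ox (os 1)) (ox (os 1)) L) ∪
    ctxSet K (eqW (oy L (os 1)) (oy L (os 1)) L) ∪ ctxSet K (eqW (on L (os 0)) (on L (os 0)) L) ∪ ctxSet K (eqW (rw' L (os 1)) (rw' L (os 1)) L) ∪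
    ctxSet K (eqW (rw' L (os 4)) (rw' L (os 4)) L) with hA0
  have rx : ∀ i < L, ctx K (eqv ((os 0).inp i) ((os 0).inp i)) ∈ Γ ∪ A0 := fun i hi => Or.inr (Or.inl (Or.inl (Or.inl (Or.inl (Or.inl (Or.inl (mem_ctxSet (mem_eqW hi))))))))
  have ry : ∀ i < L, ctx K (eqv ((os 0).inp (L + i)) ((os 0).inp (L + i))) ∈ Γ ∪ A0 := fun i hi => Or.inr (Or.inl (Or.inl (Or.inl (Or.inl (Or.inl (Or.inr (mem_ctxSet (mem_eqW hi))))))))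
  have rz : ∀ i < L, ctx K (eqv ((os 1).inp i) ((os 1).inp i)) ∈ Γ ∪ A0 := fun i hi => Or.inr (Or.inl (Or.inl (Or.inl (Or.inl (Or.inr (mem_ctxSet (mem_eqW hi)))))))
  have rw_ : ∀ i < L, ctx K (eqv ((os 1).inp (L + i)) ((os 1).inp (L + i))) ∈ Γ ∪ A0 := fun i hi => Or.inr (Or.inl (Or.inl (Or.inl (Or.inr (mem_ctxSet (mem_eqW hi))))))
  have rn : ∀ i < L, ctx K (eqv ((os 0).inp (2 * L + i)) ((os 0).inp (2 * L + i))) ∈ Γ ∪ A0 := fun i hi => Or.inr (Or.inl (Or.inl (Or.inr (mem_ctxSet (mem_eqW hi)))))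
  have rU : ∀ i < L, ctx K (eqv ((os 1).base + resOff L i) ((os 1).base + resOff L i)) ∈ Γ ∪ A0 := fun i hi => Or.inr (Or.inl (Or.inr (mem_ctxSet (mem_eqW hi))))
  have rV : ∀ i < L, ctx K (eqv ((os 4).base + resOff L i) ((os 4).base + resOff L i)) ∈ Γ ∪ A0 := fun i hi => Or.inr (Or.inr (mem_ctxSet (mem_eqW hi)))
  -- the seven congruences with reflexive operands
  have c1 := pairP hG (Γ' := Γ ∪ A0) (ModMulU.viewOf (os 0) L) (ModMulU.Assoc.AB L (Pk L a 1)) ((v 0 (by omega)).mono hΓ) (a1.hAB.hV.mono hΓ)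
    (fun i hi => by show ctx K (eqv ((os 0).inp i) (ModMulU.Assoc.av (Pk L a 1) i)) ∈ _; rw [(i1 i hi).1]; exact rx i hi)
    (fun i hi => by show ctx K (eqv ((os 0).inp (L + i)) (ModMulU.Assoc.bv L (Pk L a 1) i)) ∈ _; rw [(i1 i hi).2.1]; exact ry i hi)
    (fun i hi => by show ctx K (eqv ((os 0).inp (2 * L + i)) (ModMulU.Assoc.nv L (Pk L a 1) i)) ∈ _; rw [(i1 i hi).2.2.2]; exact rn i hi)
  have c3 := pairP hG (Γ' := Γ ∪ A0) (ModMulU.Assoc.BC L (Pk L a 2) L) (ModMulU.viewOf (os 1) L) ((a2.hBC L le_rfl).hV.mono hΓ) ((v 1 (by omega)).mono hΓ)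
    (fun i hi => by show ctx K (eqv (ModMulU.Assoc.bv L (Pk L a 2) i) ((os 1).inp i)) ∈ _; rw [(i2 i hi).2.1]; exact rz i hi)
    (fun i hi => by show ctx K (eqv (ModMulU.Assoc.Cw L (Pk L a 2) (L - L) i) ((os 1).inp (L + i))) ∈ _; rw [Nat.sub_self, (i2 i hi).2.2.1]; exact rw_ i hi)
    (fun i hi => by show ctx K (eqv (ModMulU.Assoc.nv L (Pk L a 2) i) ((os 1).inp (2 * L + i))) ∈ _; rw [(i2 i hi).2.2.2, sh.hn 1 Nat.one_pos (by omega) i hi]; exact rn i hi)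
  have c5 := pairP hG (Γ' := Γ ∪ A0) (ModMulU.Assoc.AB L (Pk L a 2)) (ModMulU.Comm.M L (Pk L a 3) L) (a2.hAB.hV.mono hΓ) ((a3.hM L le_rfl).hV.mono hΓ)
    (fun i hi => by show ctx K (eqv (ModMulU.Assoc.av (Pk L a 2) i) (ModMulU.Comm.av (Pk L a 3) i)) ∈ _; rw [(i2 i hi).1, (i3 i hi).1]; exact ry i hi)
    (fun i hi => by show ctx K (eqv (ModMulU.Assoc.bv L (Pk L a 2) i) (ModMulU.Comm.Bw L (Pk L a 3) (L - L) i)) ∈ _; rw [Nat.sub_self, (i2 i hi).2.1, (i3 i hi).2.2.1]; exact rz i hi)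
    (fun i hi => by show ctx K (eqv (ModMulU.Assoc.nv L (Pk L a 2) i) (ModMulU.Comm.nv L (Pk L a 3) i)) ∈ _; rw [(i2 i hi).2.2.2, (i3 i hi).2.2.2]; exact rn i hi)
  have c6 := pairP hG (Γ' := Γ ∪ A0) (ModMulU.Comm.BA L (Pk L a 3)) (ModMulU.Assoc.AB L (Pk L a 4)) (a3.hBA.hV.mono hΓ) (a4.hAB.hV.mono hΓ)
    (fun i hi => by show ctx K (eqv (ModMulU.Comm.bv L (Pk L a 3) i) (ModMulU.Assoc.av (Pk L a 4) i)) ∈ _; rw [(i3 i hi).2.1, (i4 i hi).1]; exact rz i hi)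
    (fun i hi => by show ctx K (eqv (ModMulU.Comm.av (Pk L a 3) i) (ModMulU.Assoc.bv L (Pk L a 4) i)) ∈ _; rw [(i3 i hi).1, (i4 i hi).2.1]; exact ry i hi)
    (fun i hi => by show ctx K (eqv (ModMulU.Comm.nv L (Pk L a 3) i) (ModMulU.Assoc.nv L (Pk L a 4) i)) ∈ _; rw [(i3 i hi).2.2.2, (i4 i hi).2.2.2]; exact rn i hi)
  have c8 := pairP hG (Γ' := Γ ∪ A0) (ModMulU.Assoc.BC L (Pk L a 4) L) (ModMulU.viewOf (os 4) L) ((a4.hBC L le_rfl).hV.mono hΓ) ((v 4 (by omega)).mono hΓ)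
    (fun i hi => by show ctx K (eqv (ModMulU.Assoc.bv L (Pk L a 4) i) ((os 4).inp i)) ∈ _; rw [(i4 i hi).2.1, sh.h4x i hi]; exact ry i hi)
    (fun i hi => by show ctx K (eqv (ModMulU.Assoc.Cw L (Pk L a 4) (L - L) i) ((os 4).inp (L + i))) ∈ _; rw [Nat.sub_self, (i4 i hi).2.2.1, sh.h4y i hi]; exact rw_ i hi)
    (fun i hi => by show ctx K (eqv (ModMulU.Assoc.nv L (Pk L a 4) i) ((os 4).inp (2 * L + i))) ∈ _; rw [(i4 i hi).2.2.2, sh.hn 4 (by omega) (by omega) i hi]; exact rn i hi)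
  have c10 := pairP hG (Γ' := Γ ∪ A0) (ModMulU.Assoc.AB L (Pk L a 5)) (ModMulU.viewOf (os 3) L) (a5.hAB.hV.mono hΓ) ((v 3 (by omega)).mono hΓ)
    (fun i hi => by show ctx K (eqv (ModMulU.Assoc.av (Pk L a 5) i) ((os 3).inp i)) ∈ _; rw [(i5 i hi).1, sh.h3x i hi]; exact rx i hi)
    (fun i hi => by show ctx K (eqv (ModMulU.Assoc.bv L (Pk L a 5) i) ((os 3).inp (L + i))) ∈ _; rw [(i5 i hi).2.1, sh.h3y i hi]; exact rz i hi)
    (fun i hi => by show ctx K (eqv (ModMulU.Assoc.nv L (Pk L a 5) i) ((os 3).inp (2 * L + i))) ∈ _; rw [(i5 i hi).2.2.2, sh.hn 3 (by omega) (by omega) i hi]; exact rn i hi)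
  have b1 := (((c1.union c3).union c5).union c6).union (c8.union c10)
  set A1 := A0 ∪ (((((ctxSet K (eqW ((ModMulU.viewOf (os 0) L).P L L) ((ModMulU.Assoc.AB L (Pk L a 1)).P L L) L) ∪
    ctxSet K (eqW ((ModMulU.Assoc.BC L (Pk L a 2) L).P L L) ((ModMulU.viewOf (os 1) L).P L L) L)) ∪
    ctxSet K (eqW ((ModMulU.Assoc.AB L (Pk L a 2)).P L L) ((ModMulU.Comm.M L (Pk L a 3) L).P L L) L)) ∪
    ctxSet K (eqW ((ModMulU.Comm.BA L (Pk L a 3)).P L L) ((ModMulU.Assoc.AB L (Pk L a 4)).P L L) L)) ∪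
    (ctxSet K (eqW ((ModMulU.Assoc.BC L (Pk L a 4) L).P L L) ((ModMulU.viewOf (os 4) L).P L L) L) ∪
    ctxSet K (eqW ((ModMulU.Assoc.AB L (Pk L a 5)).P L L) ((ModMulU.viewOf (os 3) L).P L L) L)))) with hA1
  have hA01 : Γ ∪ A0 ⊆ Γ ∪ A1 := Set.union_subset_union_right _ Set.subset_union_left
  have hp1 : Holds K (Γ ∪ A1) (eqW (rw' L (os 0)) ((ModMulU.Assoc.AB L (Pk L a 1)).P L L) L) := holds_viewP' hL (holds_ctxSet fun θ hθ => Or.inr (Or.inr (Or.inl (Or.inl (Or.inl (Or.inl hθ))))))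
  have hp10 : Holds K (Γ ∪ A1) (eqW ((ModMulU.Assoc.AB L (Pk L a 5)).P L L) (rw' L (os 3)) L) := holds_viewP hL (holds_ctxSet fun θ hθ => Or.inr (Or.inr (Or.inr (Or.inr hθ))))
  -- `os 2 ≅ LHS₁` and `LHS₅ ≅ os 5`
  have c2 := pairP hG (Γ' := Γ ∪ A1) (ModMulU.viewOf (os 2) L) (ModMulU.Assoc.LHS L (Pk L a 1) L) ((v 2 (by omega)).mono (hΓ.trans hA01)) ((a1.hLHS L le_rfl).hV.mono (hΓ.trans hA01))
    (fun i hi => by show ctx K (eqv ((os 2).inp i) ((ModMulU.Assoc.AB L (Pk L a 1)).P L L i)) ∈ _; rw [sh.h2x i hi]; exact holds_eqW_iff.1 hp1 i hi)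
    (fun i hi => by show ctx K (eqv ((os 2).inp (L + i)) (ModMulU.Assoc.Cw L (Pk L a 1) (L - L) i)) ∈ _; rw [Nat.sub_self, sh.h2y i hi, (i1 i hi).2.2.1]; exact hA01 (rU i hi))
    (fun i hi => by show ctx K (eqv ((os 2).inp (2 * L + i)) (ModMulU.Assoc.nv L (Pk L a 1) i)) ∈ _; rw [sh.hn 2 (by omega) (by omega) i hi, (i1 i hi).2.2.2]; exact hA01 (rn i hi))
  have c11 := pairP hG (Γ' := Γ ∪ A1) (ModMulU.Assoc.LHS L (Pk L a 5) L) (ModMulU.viewOf (os 5) L) ((a5.hLHS L le_rfl).hV.mono (hΓ.trans hA01)) ((v 5 (by omega)).mono (hΓ.trans hA01))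
    (fun i hi => by show ctx K (eqv ((ModMulU.Assoc.AB L (Pk L a 5)).P L L i) ((os 5).inp i)) ∈ _; rw [sh.h5x i hi]; exact holds_eqW_iff.1 hp10 i hi)
    (fun i hi => by show ctx K (eqv (ModMulU.Assoc.Cw L (Pk L a 5) (L - L) i) ((os 5).inp (L + i))) ∈ _; rw [Nat.sub_self, (i5 i hi).2.2.1, sh.h5y i hi]; exact hA01 (rV i hi))
    (fun i hi => by show ctx K (eqv (ModMulU.Assoc.nv L (Pk L a 5) i) ((os 5).inp (2 * L + i))) ∈ _; rw [(i5 i hi).2.2.2, sh.hn 5 (by omega) (by omega) i hi]; exact hA01 (rn i hi))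
  have h := (b0.trans b1).trans (c2.union c11)
  refine ⟨_, h.mono_size (by simp only [pdSize]; nlinarith [Nat.zero_le K.size, Nat.zero_le L]), ?_⟩
  have liftA1 : Γ ∪ A1 ⊆ Γ ∪ (A1 ∪ (ctxSet K (eqW ((ModMulU.viewOf (os 2) L).P L L) ((ModMulU.Assoc.LHS L (Pk L a 1) L).P L L) L) ∪
      ctxSet K (eqW ((ModMulU.Assoc.LHS L (Pk L a 5) L).P L L) ((ModMulU.viewOf (os 5) L).P L L) L))) := Set.union_subset_union_right _ Set.subset_union_left
  have liftA0 := hA01.trans liftA1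
  exact ⟨holds_ctxSet fun θ hθ => liftA0 (Or.inr (Or.inl (Or.inl (Or.inl (Or.inl (Or.inl (Or.inl hθ))))))),
    holds_ctxSet fun θ hθ => liftA0 (Or.inr (Or.inl (Or.inl (Or.inl (Or.inl (Or.inl (Or.inr hθ))))))),
    holds_ctxSet fun θ hθ => liftA0 (Or.inr (Or.inl (Or.inl (Or.inl (Or.inl (Or.inr hθ)))))),
    holds_ctxSet fun θ hθ => liftA0 (Or.inr (Or.inl (Or.inl (Or.inl (Or.inr hθ))))),
    holds_ctxSet fun θ hθ => liftA0 (Or.inr (Or.inl (Or.inl (Or.inr hθ)))),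
    holds_ctxSet fun θ hθ => liftA0 (Or.inr (Or.inl (Or.inr hθ))),
    holds_ctxSet fun θ hθ => liftA0 (Or.inr (Or.inr hθ)),
    hp1.mono liftA1,
    holds_viewP' hL (holds_ctxSet fun θ hθ => Or.inr (Or.inr (Or.inl hθ))),
    (holds_viewP hL (holds_ctxSet fun θ hθ => (Or.inr (Or.inr (Or.inl (Or.inl (Or.inl (Or.inr hθ))))) : _ ∈ Γ ∪ A1))).mono liftA1,
    (holds_ctxSet fun θ hθ => (Or.inr (Or.inr (Or.inl (Or.inl (Or.inr hθ)))) : _ ∈ Γ ∪ A1)).mono liftA1,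
    (holds_ctxSet fun θ hθ => (Or.inr (Or.inr (Or.inl (Or.inr hθ))) : _ ∈ Γ ∪ A1)).mono liftA1,
    (holds_viewP hL (holds_ctxSet fun θ hθ => (Or.inr (Or.inr (Or.inr (Or.inl hθ))) : _ ∈ Γ ∪ A1))).mono liftA1,
    hp10.mono liftA1,
    holds_viewP hL (holds_ctxSet fun θ hθ => Or.inr (Or.inr (Or.inr hθ)))⟩

/-! ### Phase Q: the chain of equalities -/

/-- **Phase Q**: from the laws and the congruences, `res (os 2) ≡ res (os 5)`. [folklore] -/
theorem phaseQ (hG : MRules G) (hL : 0 < L) {Γ' : Set (PropForm ℕ)} (hA : a.Avail (medT L) (7 * L) K Γ') (hw : AuxWired (7 * L) (medSrc L) os a)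
    (fL : FactsL L a K Γ') (fP : FactsP L a os K Γ') :
    G.Yields Γ' (ctxSet K (eqW (rw' L (os 2)) (rw' L (os 5)) L)) (4 * pdSize L K.size + 13 * (L * (K.size + 10))) := by
  have hΓ : ∀ {X : Set (PropForm ℕ)}, Γ' ⊆ Γ' ∪ X := fun {X} => Set.subset_union_left
  obtain ⟨-, a1, a2, -, a4, a5⟩ := kits_avail hL hA
  obtain ⟨i1, i2, -, i4, i5, -⟩ := kit_inps (L := L) (a := a) (os := os) hw
  -- `U ≡ P(BC₂)`, so `BC₁ ≅ ABC₂`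
  have b1 := Yields.eqW_symm hG.arith.logic fP.p3
  set A1 := ctxSet K (eqW (rw' L (os 1)) ((ModMulU.Assoc.BC L (Pk L a 2) L).P L L) L) with hA1
  have b2 := pairP hG (Γ' := Γ' ∪ A1) (ModMulU.Assoc.BC L (Pk L a 1) L) (ModMulU.Assoc.ABC L (Pk L a 2) L) ((a1.hBC L le_rfl).hV.mono hΓ) ((a2.hABC L le_rfl).hV.mono hΓ)
    (fun i hi => by show ctx K (eqv (ModMulU.Assoc.bv L (Pk L a 1) i) (ModMulU.Assoc.av (Pk L a 2) i)) ∈ _; rw [(i1 i hi).2.1, (i2 i hi).1]; exact hΓ (holds_eqW_iff.1 fP.ry i hi))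
    (fun i hi => by show ctx K (eqv (ModMulU.Assoc.Cw L (Pk L a 1) (L - L) i) ((ModMulU.Assoc.BC L (Pk L a 2) L).P L L i)) ∈ _; rw [Nat.sub_self, (i1 i hi).2.2.1]; exact Or.inr (mem_ctxSet (mem_eqW hi)))
    (fun i hi => by show ctx K (eqv (ModMulU.Assoc.nv L (Pk L a 1) i) (ModMulU.Assoc.nv L (Pk L a 2) i)) ∈ _; rw [(i1 i hi).2.2.2, (i2 i hi).2.2.2]; exact hΓ (holds_eqW_iff.1 fP.rn i hi))
  set A2 := A1 ∪ ctxSet K (eqW ((ModMulU.Assoc.BC L (Pk L a 1) L).P L L) ((ModMulU.Assoc.ABC L (Pk L a 2) L).P L L) L) with hA2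
  -- `P(AB₂) ≡ P(M₃) ≡ P(BA₃) ≡ P(AB₄)`, so `LHS₂ ≅ LHS₄`
  have b3 := Yields.eqW_trans hG.arith.logic (K := K) (Γ := Γ' ∪ A2) (fP.p5.mono hΓ) (fL.e3.mono hΓ)
  set A3 := A2 ∪ ctxSet K (eqW ((ModMulU.Assoc.AB L (Pk L a 2)).P L L) ((ModMulU.Comm.BA L (Pk L a 3)).P L L) L) with hA3
  have b4 := Yields.eqW_trans hG.arith.logic (K := K) (Γ := Γ' ∪ A3) (a := (ModMulU.Assoc.AB L (Pk L a 2)).P L L) (b := (ModMulU.Comm.BA L (Pk L a 3)).P L L)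
    (d := (ModMulU.Assoc.AB L (Pk L a 4)).P L L) (holds_ctxSet fun θ hθ => Or.inr (Or.inr hθ)) (fP.p6.mono hΓ)
  set A4 := A3 ∪ ctxSet K (eqW ((ModMulU.Assoc.AB L (Pk L a 2)).P L L) ((ModMulU.Assoc.AB L (Pk L a 4)).P L L) L) with hA4
  have b5 := pairP hG (Γ' := Γ' ∪ A4) (ModMulU.Assoc.LHS L (Pk L a 2) L) (ModMulU.Assoc.LHS L (Pk L a 4) L) ((a2.hLHS L le_rfl).hV.mono hΓ) ((a4.hLHS L le_rfl).hV.mono hΓ)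
    (fun i hi => Or.inr (Or.inr (mem_ctxSet (mem_eqW hi))))
    (fun i hi => by show ctx K (eqv (ModMulU.Assoc.Cw L (Pk L a 2) (L - L) i) (ModMulU.Assoc.Cw L (Pk L a 4) (L - L) i)) ∈ _; rw [Nat.sub_self, (i2 i hi).2.2.1, (i4 i hi).2.2.1]; exact hΓ (holds_eqW_iff.1 fP.rw i hi))
    (fun i hi => by show ctx K (eqv (ModMulU.Assoc.nv L (Pk L a 2) i) (ModMulU.Assoc.nv L (Pk L a 4) i)) ∈ _; rw [(i2 i hi).2.2.2, (i4 i hi).2.2.2]; exact hΓ (holds_eqW_iff.1 fP.rn i hi))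
  set A5 := A4 ∪ ctxSet K (eqW ((ModMulU.Assoc.LHS L (Pk L a 2) L).P L L) ((ModMulU.Assoc.LHS L (Pk L a 4) L).P L L) L) with hA5
  -- `LHS₄ ≡ ABC₄ ≅ BC₅`
  have b6 := Yields.eqW_symm hG.arith.logic (fL.e4.mono (hΓ (X := A5)))
  set A6 := A5 ∪ ctxSet K (eqW ((ModMulU.Assoc.LHS L (Pk L a 4) L).P L L) ((ModMulU.Assoc.ABC L (Pk L a 4) L).P L L) L) with hA6
  have b7 := pairP hG (Γ' := Γ' ∪ A6) (ModMulU.Assoc.ABC L (Pk L a 4) L) (ModMulU.Assoc.BC L (Pk L a 5) L) ((a4.hABC L le_rfl).hV.mono hΓ) ((a5.hBC L le_rfl).hV.mono hΓ)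
    (fun i hi => by show ctx K (eqv (ModMulU.Assoc.av (Pk L a 4) i) (ModMulU.Assoc.bv L (Pk L a 5) i)) ∈ _; rw [(i4 i hi).1, (i5 i hi).2.1]; exact hΓ (holds_eqW_iff.1 fP.rz i hi))
    (fun i hi => by show ctx K (eqv ((ModMulU.Assoc.BC L (Pk L a 4) L).P L L i) (ModMulU.Assoc.Cw L (Pk L a 5) (L - L) i)) ∈ _; rw [Nat.sub_self, (i5 i hi).2.2.1]; exact hΓ (holds_eqW_iff.1 fP.p8 i hi))
    (fun i hi => by show ctx K (eqv (ModMulU.Assoc.nv L (Pk L a 4) i) (ModMulU.Assoc.nv L (Pk L a 5) i)) ∈ _; rw [(i4 i hi).2.2.2, (i5 i hi).2.2.2]; exact hΓ (holds_eqW_iff.1 fP.rn i hi))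
  set A7 := A6 ∪ ctxSet K (eqW ((ModMulU.Assoc.ABC L (Pk L a 4) L).P L L) ((ModMulU.Assoc.BC L (Pk L a 5) L).P L L) L) with hA7
  -- the chain `P(BC₁) ≡ P(ABC₂) ≡ P(LHS₂) ≡ P(LHS₄) ≡ P(ABC₄) ≡ P(BC₅)`
  have b8 := Yields.eqW_trans hG.arith.logic (K := K) (Γ := Γ' ∪ A7) (a := (ModMulU.Assoc.BC L (Pk L a 1) L).P L L) (b := (ModMulU.Assoc.ABC L (Pk L a 2) L).P L L)
    (d := (ModMulU.Assoc.LHS L (Pk L a 2) L).P L L) (holds_ctxSet fun θ hθ => Or.inr (Or.inl (Or.inl (Or.inl (Or.inl (Or.inl (Or.inr hθ))))))) (fL.e2.mono hΓ)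
  set A8 := A7 ∪ ctxSet K (eqW ((ModMulU.Assoc.BC L (Pk L a 1) L).P L L) ((ModMulU.Assoc.LHS L (Pk L a 2) L).P L L) L) with hA8
  have b9 := Yields.eqW_trans hG.arith.logic (K := K) (Γ := Γ' ∪ A8) (a := (ModMulU.Assoc.BC L (Pk L a 1) L).P L L) (b := (ModMulU.Assoc.LHS L (Pk L a 2) L).P L L)
    (d := (ModMulU.Assoc.LHS L (Pk L a 4) L).P L L) (holds_ctxSet fun θ hθ => Or.inr (Or.inr hθ)) (holds_ctxSet fun θ hθ => Or.inr (Or.inl (Or.inl (Or.inl (Or.inr hθ)))))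
  set A9 := A8 ∪ ctxSet K (eqW ((ModMulU.Assoc.BC L (Pk L a 1) L).P L L) ((ModMulU.Assoc.LHS L (Pk L a 4) L).P L L) L) with hA9
  have b10 := Yields.eqW_trans hG.arith.logic (K := K) (Γ := Γ' ∪ A9) (a := (ModMulU.Assoc.BC L (Pk L a 1) L).P L L) (b := (ModMulU.Assoc.LHS L (Pk L a 4) L).P L L)
    (d := (ModMulU.Assoc.ABC L (Pk L a 4) L).P L L) (holds_ctxSet fun θ hθ => Or.inr (Or.inr hθ)) (holds_ctxSet fun θ hθ => Or.inr (Or.inl (Or.inl (Or.inl (Or.inr hθ)))))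
  set A10 := A9 ∪ ctxSet K (eqW ((ModMulU.Assoc.BC L (Pk L a 1) L).P L L) ((ModMulU.Assoc.ABC L (Pk L a 4) L).P L L) L) with hA10
  have b11 := Yields.eqW_trans hG.arith.logic (K := K) (Γ := Γ' ∪ A10) (a := (ModMulU.Assoc.BC L (Pk L a 1) L).P L L) (b := (ModMulU.Assoc.ABC L (Pk L a 4) L).P L L)
    (d := (ModMulU.Assoc.BC L (Pk L a 5) L).P L L) (holds_ctxSet fun θ hθ => Or.inr (Or.inr hθ)) (holds_ctxSet fun θ hθ => Or.inr (Or.inl (Or.inl (Or.inl (Or.inr hθ)))))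
  set A11 := A10 ∪ ctxSet K (eqW ((ModMulU.Assoc.BC L (Pk L a 1) L).P L L) ((ModMulU.Assoc.BC L (Pk L a 5) L).P L L) L) with hA11
  -- `ABC₁ ≅ ABC₅`
  have b12 := pairP hG (Γ' := Γ' ∪ A11) (ModMulU.Assoc.ABC L (Pk L a 1) L) (ModMulU.Assoc.ABC L (Pk L a 5) L) ((a1.hABC L le_rfl).hV.mono hΓ) ((a5.hABC L le_rfl).hV.mono hΓ)
    (fun i hi => by show ctx K (eqv (ModMulU.Assoc.av (Pk L a 1) i) (ModMulU.Assoc.av (Pk L a 5) i)) ∈ _; rw [(i1 i hi).1, (i5 i hi).1]; exact hΓ (holds_eqW_iff.1 fP.rx i hi))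
    (fun i hi => Or.inr (Or.inr (mem_ctxSet (mem_eqW hi))))
    (fun i hi => by show ctx K (eqv (ModMulU.Assoc.nv L (Pk L a 1) i) (ModMulU.Assoc.nv L (Pk L a 5) i)) ∈ _; rw [(i1 i hi).2.2.2, (i5 i hi).2.2.2]; exact hΓ (holds_eqW_iff.1 fP.rn i hi))
  set A12 := A11 ∪ ctxSet K (eqW ((ModMulU.Assoc.ABC L (Pk L a 1) L).P L L) ((ModMulU.Assoc.ABC L (Pk L a 5) L).P L L) L) with hA12
  -- the final chain `res (os 2) ≡ P(LHS₁) ≡ P(ABC₁) ≡ P(ABC₅) ≡ P(LHS₅) ≡ res (os 5)`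
  have b13 := Yields.eqW_symm hG.arith.logic (fL.e1.mono (hΓ (X := A12)))
  set A13 := A12 ∪ ctxSet K (eqW ((ModMulU.Assoc.LHS L (Pk L a 1) L).P L L) ((ModMulU.Assoc.ABC L (Pk L a 1) L).P L L) L) with hA13
  have b14 := Yields.eqW_trans hG.arith.logic (K := K) (Γ := Γ' ∪ A13) (a := rw' L (os 2)) (b := (ModMulU.Assoc.LHS L (Pk L a 1) L).P L L) (d := (ModMulU.Assoc.ABC L (Pk L a 1) L).P L L)
    (fP.p2.mono hΓ) (holds_ctxSet fun θ hθ => Or.inr (Or.inr hθ))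
  set A14 := A13 ∪ ctxSet K (eqW (rw' L (os 2)) ((ModMulU.Assoc.ABC L (Pk L a 1) L).P L L) L) with hA14
  have b15 := Yields.eqW_trans hG.arith.logic (K := K) (Γ := Γ' ∪ A14) (a := rw' L (os 2)) (b := (ModMulU.Assoc.ABC L (Pk L a 1) L).P L L) (d := (ModMulU.Assoc.ABC L (Pk L a 5) L).P L L)
    (holds_ctxSet fun θ hθ => Or.inr (Or.inr hθ)) (holds_ctxSet fun θ hθ => Or.inr (Or.inl (Or.inl (Or.inr hθ))))
  set A15 := A14 ∪ ctxSet K (eqW (rw' L (os 2)) ((ModMulU.Assoc.ABC L (Pk L a 5) L).P L L) L) with hA15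
  have b16 := Yields.eqW_trans hG.arith.logic (K := K) (Γ := Γ' ∪ A15) (a := rw' L (os 2)) (b := (ModMulU.Assoc.ABC L (Pk L a 5) L).P L L) (d := (ModMulU.Assoc.LHS L (Pk L a 5) L).P L L)
    (holds_ctxSet fun θ hθ => Or.inr (Or.inr hθ)) (fL.e5.mono hΓ)
  set A16 := A15 ∪ ctxSet K (eqW (rw' L (os 2)) ((ModMulU.Assoc.LHS L (Pk L a 5) L).P L L) L) with hA16
  have b17 := Yields.eqW_trans hG.arith.logic (K := K) (Γ := Γ' ∪ A16) (a := rw' L (os 2)) (b := (ModMulU.Assoc.LHS L (Pk L a 5) L).P L L) (d := rw' L (os 5))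
    (holds_ctxSet fun θ hθ => Or.inr (Or.inr hθ)) (fP.p11.mono hΓ)
  have h := (((((((((((((((b1.trans b2).trans b3).trans b4).trans b5).trans b6).trans b7).trans b8).trans b9).trans b10).trans b11).trans b12).trans b13).trans b14).trans
    b15).trans b16).trans b17
  refine (h.mono_right fun θ hθ => Or.inr hθ).mono_size ?_
  simp only [pdSize]; nlinarith [Nat.zero_le K.size, Nat.zero_le L]

/-! ### The medial law -/

/-- Size coefficient of the medial law. [folklore] -/
def medC (L : ℕ) : ℕ × ℕ := (711000 * ((L + 1) * (L + 1) * (L + 1) * (L + 1)), 153)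

/-- **The medial law of the kit**: `(x ∘ y) ∘ (z ∘ w) = (x ∘ z) ∘ (y ∘ w)` bitwise for
`x, y, z, w < n`. [cite: Krajicek1995, §9.2] -/
theorem medial (hG : MRules G) (hL : 0 < L) {m : ℕ} (hm : m + 2 ≤ L) (hos : ∀ j < 6, (os j).Avail (ModMulU.mulRT L) (3 * L) K Γ)
    (sh : MShape L (fun o i => o.base + resOff L i) os) (hA : a.Avail (medT L) (7 * L) K Γ) (hw : AuxWired (7 * L) (medSrc L) os a)
    (hx : LtN L K Γ (ox (os 0)) (on L (os 0))) (hy : LtN L K Γ (oy L (os 0)) (on L (os 0))) (hz : LtN L K Γ (ox (os 1)) (on L (os 0)))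
    (_hw' : LtN L K Γ (oy L (os 1)) (on L (os 0))) (hg : GlobW L m K Γ (on L (os 0))) :
    G.Yields Γ (ctxSet K (eqW (fun i => (os 2).base + resOff L i) (fun i => (os 5).base + resOff L i) L)) ((medC L).1 * (K.size + (medC L).2)) := by
  have hΓ : ∀ {X : Set (PropForm ℕ)}, Γ ⊆ Γ ∪ X := fun {X} => Set.subset_union_left
  obtain ⟨D1, b1, fT⟩ := phaseT hG hL hA hw hx hy hz
  obtain ⟨D2, b2, fL⟩ := phaseL hG hL hm (hA.mono hΓ) hw (hg.mono hΓ) fT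
  rw [Set.union_assoc] at fL
  obtain ⟨D3, b3, fP⟩ := phaseP hG hL (fun j hj => (hos j hj).mono (hΓ (X := D1 ∪ D2))) sh (hA.mono hΓ) hw
  rw [Set.union_assoc] at fP
  have b4 := phaseQ hG hL (hA.mono (hΓ (X := D1 ∪ D2 ∪ D3))) hw (fL.mono (Set.union_subset_union_right _ Set.subset_union_left)) fP
  have h := ((b1.trans b2).trans b3).trans b4
  refine (h.mono_right fun θ hθ => Or.inr hθ).mono_size ?_
  simp only [medC, pdSize]
  have hP : ∀ {t : ℕ}, t ≤ 4 → (L + 1) ^ t ≤ (L + 1) * (L + 1) * (L + 1) * (L + 1) := fun {t} ht => by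
    calc (L + 1) ^ t ≤ (L + 1) ^ 4 := Nat.pow_le_pow_right (Nat.succ_pos L) ht
      _ = _ := by ring
  have h1 : L ≤ (L + 1) * (L + 1) * (L + 1) * (L + 1) := by have := hP (t := 1) (by norm_num); rw [pow_one] at this; omega
  have h2 : L * L ≤ (L + 1) * (L + 1) * (L + 1) * (L + 1) := by have := hP (t := 2) (by norm_num); nlinarith
  have hK : K.size + 10 ≤ K.size + 153 := by omega
  nlinarith [Nat.mul_le_mul h1 hK, Nat.mul_le_mul h2 hK, Nat.zero_le ((L + 1) * (L + 1) * (L + 1) * (L + 1) * (K.size + 153))]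

end Law

end MulKit

end Literature.Computability.MetaComplexity
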